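import Literature.Analysis.FunctionSpaces.TorusFourierSynthesis
import Literature.Analysis.UnboundedOperators.HeatKernelFourier
import Literature.Analysis.FluidPDE.OnsagerBDSVProofs
import Literature.Analysis.FluidPDE.DeRosaScheme
import Literature.Analysis.FluidPDE.FracLaplacianSpaceTime
import HarnessLib

/-!
# Proof of the De Rosa time-regularity step (discharge of `DeRosa.timeRegularity`)

Analysis/FluidPDE proofs file (theorems only: no definitions, no named facts). It discharges the
named fact `Literature.Analysis.FluidPDE.DeRosa.timeRegularity` (`FluidPDE/DeRosaScheme`), the
time-regularity step in the proof of Thm. 2.1 of L. De Rosa, *Infinitely many Leray–Hopf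
solutions for the fractional Navier–Stokes equations*, Comm. PDE 44 (2019) 335–365 =
arXiv:1801.10235, §4.2 (pp. 9–10 of the arXiv text): if classical triples `(v_q, p_q, R_q)`
solving the fractional Navier–Stokes–Reynolds system
`∂ₜv + div(v ⊗ v) + ∇p + (-Δ)^γ v = div R` (`0 < γ < 1/3`, viscosity `1`) on `[0,T] × 𝕋³`
converge, `v_q → u` uniformly with `‖R_q‖₀ → 0`, and the slices `v_q(t)` are `β'`-Hölder
uniformly in `q, t` (`0 < β' < 1/3`), then `u ∈ C^{β''}([0,T] × 𝕋³)` for every `β'' < β'`. The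
main result is `Literature.Analysis.FluidPDE.DeRosa.timeRegularity_holds : DeRosa.timeRegularity`;
with `DeRosaSchemeProofs` and `HypodissipativeLerayNonuniquenessDeRosaProofs` this reduces the
trust base of `DeRosa2019_thm21` (De Rosa's Thm. 2.1) and of the barrier
`HypodissipativeLerayNonuniqueness` (De Rosa's Thm. 1.2) to the convex-integration iteration
`DeRosa.iterativeSchemeLT` (`DeRosaStep`: Prop. 4.1 run from zero, in the regime `γ < β` covered
by its printed proof) alone.

## The argument (De Rosa 2019, §4.2, last paragraph; after BDSV 2019, §2.2)

De Rosa mollifies in space, `ṽ = v ⋆ ψ_ℓ`, uses `‖ṽ - v‖₀ ≲ [v]_{β'} ℓ^{β'}`, the equation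
`∂ₜṽ + div(v ⊗ v) ⋆ ψ_ℓ + ∇p ⋆ ψ_ℓ + (-Δ)^γ ṽ = 0`, Schauder estimates for `∇p ⋆ ψ_ℓ`, the bound
`‖(-Δ)^γ ṽ‖₀ ≤ ‖ṽ‖₁` (his Thm. 7.1, `2γ < 1`) and interpolation in time. We follow the route of the
tree's discharge of the Euler version (`BDSV.timeRegularity_holds`, `OnsagerBDSVProofs`): the
mollifier is the Gauss–Weierstrass kernel at `ℓ = √τ` (`e^{τΔ}` acting on periodic lifts to
`ℝ^d`), the Schauder estimate is replaced by the heat-flow representation of the mollified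
pressure gradient (`TorusHeatFlow`), and everything is done at level `q` (all fields smooth), the
limit `q → ∞` being taken at the end. Two ingredients are new:

* **The pressure equation of the fractional system** is still `Δp = div div (R - v ⊗ v)`
  (`Torus.IsFracNSReynoldsOn.laplacian_lift_pressure`), because the hypodissipative term is
  divergence free: `div (-Δ)^γ v = 0` for smooth divergence-free `v`
  (`Torus.isDivFree_fracLaplacian`, in Fourier variables `𝓕(div (-Δ)^γ v)(k) = 2πi (4π²|k|²)^γ k·v̂(k) = 0`).
* **The mollified hypodissipative term**, for which we prove the classical semigroup bound
  `‖e^{τΔ} ((-Δ)^γ a)~‖₀ ≤ K ‖a‖₀ τ^{-γ}` (`Torus.exists_norm_heatExtension_lift_fracLaplacian_le`)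
  by *subordination*: the Fourier expansion of the heat flow of a lifted smooth function,
  `e^{σΔ} g̃ = ∑ₖ e^{-4π²σ|k|²} e_k ĝ(k)` (`Torus.hasSum_heatExtension_lift`, from Fourier inversion
  and `𝓕 G_σ = e^{-4π²σ|ξ|²}`), Euler's integral `e^{-τλ} λ^γ = Γ(1-γ)⁻¹ ∫₀^∞ s^{-γ} λ e^{-(τ+s)λ} ds`,
  and summation under the integral sign give
  `e^{τΔ} (-Δ)^γ a = Γ(1-γ)⁻¹ ∫₀^∞ s^{-γ} e^{(τ+s)Δ} (-Δa) ds`; the second-order smoothing bound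
  `‖e^{σΔ}(Δa)~‖₀ ≤ C_Δ σ⁻¹ ‖a‖₀` (two gradient steps through `e^{σΔ} = e^{(σ/2)Δ} e^{(σ/2)Δ}`,
  Giga–Giga–Saal 2010, §1.1.3) and `∫₀^∞ s^{-γ} (τ+s)⁻¹ ds ≤ (1/(1-γ) + 1/γ) τ^{-γ}` conclude.

Hence, for interior times `0 < t₁ ≤ t₂ < T`,
`‖v_q(t₂) - v_q(t₁)‖₀ ≤ 2K₀[v_q]_{β'} τ^{β'/2} + (t₂-t₁)(K_A ‖v_q‖₀[v_q]_{β'} τ^{(β'-1)/2} + K_B ‖R_q‖₀ τ^{-1/2} + K_C ‖v_q‖₀ τ^{-γ})`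
(`Torus.exists_norm_lift_sub_lift_le_frac`); letting `q → ∞` kills the stress term, and
`τ = (t₂-t₁)²` gives `‖u(t₂) - u(t₁)‖₀ ≤ K |t₂-t₁|^{β'} + K' |t₂-t₁|^{1-2γ} ≲_T |t₂-t₁|^{β'}`
(`DeRosa.exists_norm_sub_le_of_unifLimit`; `1 - 2γ > 1/3 > β'`), extended to `[0,T]` by continuity
of `u` (`BDSV.norm_sub_le_Icc_of_Ioo`). The spatial bound `[u(t)]_{β'} ≤ C` passes to the limit,
the product sup-metric combines the two, and `HolderOnWith.of_le` lowers the exponent to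
`β'' ≤ β'` on the bounded set `[0,T] × 𝕋³` (so the statement is proved with `β'' = β'` as well,
the sharp form of Colombo–De Rosa 2020, Thm. 1.1, in this smooth approximation setting).

## Contents

* Fourier side: `Torus.integral_heatKernel_mul_mFourier_proj_sub` (the Gauss kernel against a
  character), `Torus.hasSum_heatExtension_lift`, `Torus.mFourierCoeff_complexify_fracLaplacian`,
  `Torus.hasSum_heatExtension_lift_fracLaplacian`, `Torus.hasSum_heatExtension_lift_laplacian`.
* Subordination: `Torus.integral_rpow_neg_mul_exp`, `Torus.exp_mul_rpow_eq_integral`,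
  `Torus.integral_rpow_neg_mul_inv_add_le`, `Torus.norm_heatExtension_lift_laplacian_le_of_bound`,
  `Torus.exists_norm_heatExtension_lift_fracLaplacian_le`.
* The fractional system lifted to `ℝ^d`: `Torus.isDivFree_fracLaplacian`,
  `Torus.IsFracNSReynoldsOn.isClassicalNSSolutionOn_lift`, `.laplacian_lift_pressure`,
  `.deriv_lift_velocity_apply`.
* The BDSV chain for the fractional system: `Torus.exists_norm_heatExtension_lift_timeDerivWithin_le_frac`,
  `Torus.exists_norm_lift_sub_lift_le_frac`, `DeRosa.exists_norm_sub_le_of_unifLimit`,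
  `DeRosa.timeRegularity_holds`.

All constants are existentially quantified and depend only on the dimension and the exponents.

## References

* L. De Rosa, Comm. PDE 44 (2019), 335–365 = arXiv:1801.10235, §4.2 (proof of Thm. 2.1, time
  regularity, pp. 9–10), §4.1 (NSR), Thm. 7.1. [`Derosa2018`]
* T. Buckmaster, C. De Lellis, L. Székelyhidi Jr., V. Vicol, *Onsager's conjecture for admissible
  weak solutions*, CPAM 72 (2019) = arXiv:1701.08678, §2.2 (time regularity). [`BuckmasterEtAl2018`]
* M. Colombo, L. De Rosa, *Regularity in time of Hölder solutions of Euler and hypodissipative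
  Navier–Stokes equations*, SIAM J. Math. Anal. 52 (2020), Thm. 1.1. [`ColomboRosa2020`]
* T. Luo, E. S. Titi, Calc. Var. PDE 59 (2020) = arXiv:1808.07595, §2.1 (2.1) (the fractional
  Navier–Stokes–Reynolds system). [`LuoTiti2020`]
* L. Grafakos, *Classical Fourier Analysis*, 3rd ed., GTM 249 (2014), Prop. 3.2.5, Prop. 3.2.6 (8),
  §3.3.1 (Fourier series of smooth functions on `𝕋ⁿ`). [`Grafakos2014`]
* M.-H. Giga, Y. Giga, J. Saal, *Nonlinear Partial Differential Equations*, Birkhäuser 2010,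
  §1.1.3 (`L^∞` gradient bounds for the heat semigroup). [`GigaGigaSaal2010`]
-/

noncomputable section

open MeasureTheory Set Filter Topology UnitAddTorus
open Literature.Analysis.UnboundedOperators Literature.Analysis.FunctionSpaces
open scoped Real ENNReal NNReal FourierTransform ContDiff Laplacian

namespace Literature.Analysis.FluidPDE

namespace Torus

variable {d : Type*} [Fintype d]

/-- The lifted character in exponential form: `e_k(proj y) = exp (2πi ∑ᵢ kᵢ yᵢ)`. [folklore] -/
theorem mFourier_proj_eq_cexp (k : d → ℤ) (y : EuclideanSpace ℝ d) :
    mFourier k (FunctionSpaces.Torus.proj y) =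
      Complex.exp (2 * π * Complex.I * ∑ i, ((k i : ℝ) : ℂ) * ((y i : ℝ) : ℂ)) := by
  simp only [mFourier, ContinuousMap.coe_mk, FunctionSpaces.Torus.proj_apply, fourier_coe_apply,
    ← Complex.exp_sum]
  congr 1
  push_cast
  rw [Finset.mul_sum]
  refine Finset.sum_congr rfl fun i _ => ?_
  simp
  ring

variable [DecidableEq d]

/-- `⟪y, latticeVec k⟫ = ∑ᵢ kᵢ yᵢ`. [folklore] -/
theorem inner_latticeVec_right (k : d → ℤ) (y : EuclideanSpace ℝ d) :
    @inner ℝ _ _ y (FunctionSpaces.Torus.latticeVec k) = ∑ i, (k i : ℝ) * y i := by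
  simp [PiLp.inner_apply]

/-- `‖latticeVec k‖² = |k|²`. [folklore] -/
theorem norm_latticeVec_sq (k : d → ℤ) :
    ‖FunctionSpaces.Torus.latticeVec k‖ ^ 2 = FunctionSpaces.Torus.freqNormSq k := by
  rw [EuclideanSpace.real_norm_sq_eq, FunctionSpaces.Torus.freqNormSq]
  simp

/-- **The Gauss–Weierstrass kernel against a character**: for `σ > 0`,
`∫ G_σ(y) e_k(proj (x - y)) dy = e^{-4π²σ|k|²} e_k(proj x)` (the Fourier transform of the heat
kernel, `𝓕 G_σ (ξ) = e^{-4π²σ|ξ|²}`, at the lattice point `ξ = k`). [folklore] -/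
theorem integral_heatKernel_mul_mFourier_proj_sub {σ : ℝ} (hσ : 0 < σ) (k : d → ℤ)
    (x : EuclideanSpace ℝ d) :
    ∫ y, (heatKernel σ y : ℂ) * mFourier k (FunctionSpaces.Torus.proj (x - y)) =
      (Real.exp (-(4 * π ^ 2 * σ * FunctionSpaces.Torus.freqNormSq k)) : ℂ) *
        mFourier k (FunctionSpaces.Torus.proj x) := by
  have hF := fourierIntegral_heatKernel_holds (E := EuclideanSpace ℝ d) hσ (FunctionSpaces.Torus.latticeVec k)
  rw [Real.fourier_eq'] at hF
  have hsplit : ∀ y : EuclideanSpace ℝ d, (heatKernel σ y : ℂ) * mFourier k (FunctionSpaces.Torus.proj (x - y)) =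
      mFourier k (FunctionSpaces.Torus.proj x) *
        (Complex.exp ((↑(-2 * π * @inner ℝ _ _ y (FunctionSpaces.Torus.latticeVec k)) * Complex.I)) *
          (heatKernel σ y : ℂ)) := by
    intro y
    rw [mFourier_proj_eq_cexp, mFourier_proj_eq_cexp, inner_latticeVec_right]
    have hxy : ∑ i, ((k i : ℝ) : ℂ) * (((x - y) i : ℝ) : ℂ) =
        ∑ i, ((k i : ℝ) : ℂ) * ((x i : ℝ) : ℂ) - ∑ i, ((k i : ℝ) : ℂ) * ((y i : ℝ) : ℂ) := by
      rw [← Finset.sum_sub_distrib]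
      refine Finset.sum_congr rfl fun i _ => ?_
      rw [PiLp.sub_apply, Complex.ofReal_sub, mul_sub]
    have hB : (((-2 * π * ∑ i, (k i : ℝ) * y i : ℝ)) : ℂ) =
        -2 * π * ∑ i, ((k i : ℝ) : ℂ) * ((y i : ℝ) : ℂ) := by
      push_cast
      rfl
    have : Complex.exp (2 * π * Complex.I * ∑ i, ((k i : ℝ) : ℂ) * (((x - y) i : ℝ) : ℂ)) =
        Complex.exp (2 * π * Complex.I * ∑ i, ((k i : ℝ) : ℂ) * ((x i : ℝ) : ℂ)) *
          Complex.exp ((((-2 * π * ∑ i, (k i : ℝ) * y i : ℝ)) : ℂ) * Complex.I) := by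
      rw [← Complex.exp_add, hxy, hB]
      congr 1
      ring
    rw [this]
    ring
  simp_rw [hsplit]
  rw [integral_const_mul]
  simp_rw [← smul_eq_mul (a := Complex.exp _), hF]
  rw [heatSymbol, mul_comm]
  congr 2
  rw [norm_latticeVec_sq]
  ring

/-- **Fourier expansion of the heat flow of lifted smooth data.** For a smooth `V`-valued
function `g` on `T^d` (`V` a complex Banach space), `σ > 0` and `x ∈ ℝ^d`,
`e^{σΔ} g̃ (x) = ∑ₖ e^{-4π²σ|k|²} e_k(proj x) ĝ(k)` (absolutely convergent): Fourier inversion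
`g̃ = ∑ₖ e_k ĝ(k)` (coefficients of smooth functions are absolutely summable), termwise
integration against the Gauss–Weierstrass kernel, and `𝓕 G_σ(k) = e^{-4π²σ|k|²}`
(Grafakos 2014, Prop. 3.2.5; the heat semigroup on `𝕋ⁿ` as the multiplier `e^{-4π²t|k|²}`).
[folklore] -/
theorem hasSum_heatExtension_lift {V : Type*} [NormedAddCommGroup V] [NormedSpace ℂ V]
    [CompleteSpace V] {g : UnitAddTorus d → V} (hg : FunctionSpaces.Torus.IsSmooth g) {σ : ℝ}
    (hσ : 0 < σ) (x : EuclideanSpace ℝ d) :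
    HasSum (fun k : d → ℤ => (Real.exp (-(4 * π ^ 2 * σ * FunctionSpaces.Torus.freqNormSq k)) : ℂ) •
        (mFourier k (FunctionSpaces.Torus.proj x) • mFourierCoeff g k))
      (heatExtension (FunctionSpaces.Torus.lift g) σ x) := by
  have hc : FunctionSpaces.Torus.RapidDecay (mFourierCoeff g) := hg.rapidDecay_mFourierCoeff
  have hsumm : Summable fun k => ‖mFourierCoeff g k‖ := hc.summable_norm
  -- pointwise inversion along the lift
  have hinv : ∀ y : EuclideanSpace ℝ d, FunctionSpaces.Torus.lift g y =
      ∑' k : d → ℤ, mFourier k (FunctionSpaces.Torus.proj y) • mFourierCoeff g k := fun y => by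
    have h := congrFun hg.fourierSynth_mFourierCoeff (FunctionSpaces.Torus.proj y)
    rw [FunctionSpaces.Torus.lift_apply, ← h]
    rfl
  -- the terms
  set Fk : (d → ℤ) → EuclideanSpace ℝ d → V := fun k y =>
    heatKernel σ y • (mFourier k (FunctionSpaces.Torus.proj (x - y)) • mFourierCoeff g k) with hFk
  have hFk_cont : ∀ k, Continuous (Fk k) := fun k =>
    (continuous_heatKernel σ).smul (((mFourier k).continuous.comp
      (FunctionSpaces.Torus.continuous_proj.comp (continuous_const.sub continuous_id))).smul
      continuous_const)
  have hFk_norm : ∀ k y, ‖Fk k y‖ = heatKernel σ y * ‖mFourierCoeff g k‖ := fun k y => by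
    simp only [hFk]
    rw [norm_smul, norm_smul, Real.norm_of_nonneg (heatKernel_pos hσ y).le,
      FunctionSpaces.Torus.norm_mFourier_apply, one_mul]
  have hFk_int : ∀ k, Integrable (Fk k) := fun k =>
    ((integrable_heatKernel_holds hσ).mul_const ‖mFourierCoeff g k‖).mono'
      (hFk_cont k).aestronglyMeasurable (Eventually.of_forall fun y => (hFk_norm k y).le)
  have hFk_l1 : ∀ k, ∫ y, ‖Fk k y‖ = ‖mFourierCoeff g k‖ := fun k => by
    simp_rw [hFk_norm k]
    rw [integral_mul_const, integral_heatKernel_eq_one_holds hσ, one_mul]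
  have hF_sum : Summable fun k => ∫ y, ‖Fk k y‖ := by
    simp_rw [hFk_l1]
    exact hsumm
  -- the integrand as a series
  have hseries : ∀ y : EuclideanSpace ℝ d, heatKernel σ y • FunctionSpaces.Torus.lift g (x - y) =
      ∑' k : d → ℤ, Fk k y := fun y => by
    rw [hinv (x - y)]
    exact ((FunctionSpaces.Torus.hasSum_mFourier_smul hsumm
      (FunctionSpaces.Torus.proj (x - y))).summable.tsum_const_smul (heatKernel σ y)).symm
  -- each term integrates to the claimed mode
  have hterm : ∀ k, ∫ y, Fk k y =
      (Real.exp (-(4 * π ^ 2 * σ * FunctionSpaces.Torus.freqNormSq k)) : ℂ) •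
        (mFourier k (FunctionSpaces.Torus.proj x) • mFourierCoeff g k) := fun k => by
    have h1 : ∀ y, Fk k y = ((heatKernel σ y : ℂ) * mFourier k (FunctionSpaces.Torus.proj (x - y))) •
        mFourierCoeff g k := fun y => by
      simp only [hFk]
      rw [← Complex.coe_smul, smul_smul]
    simp_rw [h1]
    rw [integral_smul_const, integral_heatKernel_mul_mFourier_proj_sub hσ k x, smul_smul]
  have hmain := hasSum_integral_of_summable_integral_norm hFk_int hF_sum
  simp_rw [hterm] at hmain
  rw [heatExtension_apply]
  simp_rw [hseries]
  exact hmain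

/-! ## Heat flow of the fractional Laplacian and of the Laplacian of a real field, in modes -/

/-- **Fourier coefficients of `(-Δ)^θ a`**: `𝓕(complexify ∘ (-Δ)^θ a)(l) = (4π²|l|²)^θ â(l)` for
smooth real `a` and `θ ≥ 0` (the mode series is continuous with these coefficients, and taking
the real part loses nothing since the coefficients are conjugate-symmetric). [folklore] -/
theorem mFourierCoeff_complexify_fracLaplacian {θ : ℝ} (hθ : 0 ≤ θ)
    {a : UnitAddTorus d → EuclideanSpace ℝ d} (ha : FunctionSpaces.Torus.IsSmooth a) (l : d → ℤ) :
    mFourierCoeff (EuclideanSpace.complexify ∘ fracLaplacian θ a) l =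
      ((fracSymbol θ l : ℝ) : ℂ) • mFourierCoeff (EuclideanSpace.complexify ∘ a) l := by
  set c : (d → ℤ) → EuclideanSpace ℂ d := fun k => mFourierCoeff (EuclideanSpace.complexify ∘ a) k
    with hc_def
  set S : UnitAddTorus d → EuclideanSpace ℂ d := fun x => ∑' k : d → ℤ,
    fracSymbol θ k • (mFourier k x • c k) with hS_def
  have hSc : Continuous S := continuous_modeSeries hθ ha
  have hfracS : fracLaplacian θ a = fun x => EuclideanSpace.realPart (S x) :=
    funext fun x => fracLaplacian_def θ a x
  have hcsymm : FunctionSpaces.Torus.IsConjSymm fun l => ((fracSymbol θ l : ℝ) : ℂ) • c l := by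
    intro l
    have h1 := FunctionSpaces.Torus.isConjSymm_mFourierCoeff ha.integrable l
    simp only [hc_def]
    rw [EuclideanSpace.conjVec_smul, Complex.conj_ofReal, ← h1, fracSymbol, fracSymbol,
      FunctionSpaces.Torus.freqNormSq_neg]
  rw [hfracS]
  exact FunctionSpaces.Torus.mFourierCoeff_complexify_realPart_comp_of_isConjSymm hSc.integrable_unitAddTorus hcsymm
    (fun k => mFourierCoeff_tsum_modes (summable_fracSymbol_mul_norm hθ ha) k) l

omit [DecidableEq d] in
/-- Complexification passes through the heat flow of lifted continuous real fields. [folklore] -/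
theorem complexify_heatExtension_lift {F : UnitAddTorus d → EuclideanSpace ℝ d} (hF : Continuous F)
    {σ : ℝ} (hσ : 0 < σ) (x : EuclideanSpace ℝ d) :
    EuclideanSpace.complexify (heatExtension (FunctionSpaces.Torus.lift F) σ x) =
      heatExtension (FunctionSpaces.Torus.lift (EuclideanSpace.complexify ∘ F)) σ x := by
  obtain ⟨C, -, hC⟩ := TorusHeat.exists_norm_lift_le hF
  exact (heatExtension_clm_comp_of_bound EuclideanSpace.complexify.toContinuousLinearMap
    (FunctionSpaces.Torus.continuous_lift_iff.2 hF) hC hσ x).symm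

/-- **The heat flow of `(-Δ)^θ a` in modes**: for smooth real `a`, `θ ≥ 0`, `σ > 0`,
`complexify (e^{σΔ} ((-Δ)^θ a)~ (x)) = ∑ₖ e^{-4π²σ|k|²} (4π²|k|²)^θ e_k(proj x) â(k)`. [folklore] -/
theorem hasSum_heatExtension_lift_fracLaplacian {θ : ℝ} (hθ : 0 ≤ θ)
    {a : UnitAddTorus d → EuclideanSpace ℝ d} (ha : FunctionSpaces.Torus.IsSmooth a) {σ : ℝ}
    (hσ : 0 < σ) (x : EuclideanSpace ℝ d) :
    HasSum (fun k : d → ℤ => ((Real.exp (-(4 * π ^ 2 * σ * FunctionSpaces.Torus.freqNormSq k)) *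
        fracSymbol θ k : ℝ) : ℂ) •
        (mFourier k (FunctionSpaces.Torus.proj x) • mFourierCoeff (EuclideanSpace.complexify ∘ a) k))
      (EuclideanSpace.complexify (heatExtension (FunctionSpaces.Torus.lift (fracLaplacian θ a)) σ x)) := by
  have hF : FunctionSpaces.Torus.IsSmooth (fracLaplacian θ a) := ha.fracLaplacian hθ
  have h := hasSum_heatExtension_lift (hF.complexify_comp) hσ x
  rw [complexify_heatExtension_lift hF.continuous hσ x]
  refine h.congr_fun fun k => ?_
  rw [mFourierCoeff_complexify_fracLaplacian hθ ha k]
  simp only [smul_smul, Complex.ofReal_mul]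
  congr 1
  ring

/-- **The heat flow of `Δa` in modes**: for smooth real `a` and `σ > 0`,
`complexify (e^{σΔ} (Δa)~ (x)) = -∑ₖ e^{-4π²σ|k|²} (4π²|k|²) e_k(proj x) â(k)`. [folklore] -/
theorem hasSum_heatExtension_lift_laplacian
    {a : UnitAddTorus d → EuclideanSpace ℝ d} (ha : FunctionSpaces.Torus.IsSmooth a) {σ : ℝ}
    (hσ : 0 < σ) (x : EuclideanSpace ℝ d) :
    HasSum (fun k : d → ℤ => -(((Real.exp (-(4 * π ^ 2 * σ * FunctionSpaces.Torus.freqNormSq k)) *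
        (4 * π ^ 2 * FunctionSpaces.Torus.freqNormSq k) : ℝ) : ℂ) •
        (mFourier k (FunctionSpaces.Torus.proj x) • mFourierCoeff (EuclideanSpace.complexify ∘ a) k)))
      (EuclideanSpace.complexify (heatExtension (FunctionSpaces.Torus.lift
        (FunctionSpaces.Torus.laplacian a)) σ x)) := by
  have hL : FunctionSpaces.Torus.IsSmooth (FunctionSpaces.Torus.laplacian a) := ha.laplacian
  have h := hasSum_heatExtension_lift (hL.complexify_comp) hσ x
  rw [complexify_heatExtension_lift hL.continuous hσ x]
  refine h.congr_fun fun k => ?_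
  rw [FunctionSpaces.Torus.mFourierCoeff_complexify_laplacian ha k]
  simp only [smul_smul, Complex.ofReal_mul, ← neg_smul]
  congr 1
  ring

/-! ## Scalar subordination: `λ^γ e^{-τλ} = Γ(1-γ)⁻¹ ∫₀^∞ s^{-γ} λ e^{-(τ+s)λ} ds` -/

omit [DecidableEq d] in
/-- `∫₀^∞ s^{-γ} λ e^{-λs} ds = Γ(1-γ) λ^γ` for `λ > 0`, `γ < 1` (Euler's integral). [folklore] -/
theorem integral_rpow_neg_mul_exp {γ : ℝ} (hγ1 : γ < 1) {lam : ℝ} (hlam : 0 < lam) :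
    ∫ s in Ioi (0 : ℝ), s ^ (-γ) * (lam * Real.exp (-(lam * s))) = Real.Gamma (1 - γ) * lam ^ γ := by
  have h := Real.integral_rpow_mul_exp_neg_mul_Ioi (a := 1 - γ) (r := lam) (by linarith) hlam
  have h1 : ∀ s : ℝ, s ^ (-γ) * (lam * Real.exp (-(lam * s))) =
      lam * (s ^ ((1 - γ) - 1) * Real.exp (-(lam * s))) := fun s => by
    rw [show (1 - γ) - 1 = -γ by ring]; ring
  simp_rw [h1]
  rw [integral_const_mul, h, one_div, Real.inv_rpow hlam.le, Real.rpow_sub hlam, Real.rpow_one]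
  field_simp

omit [DecidableEq d] in
/-- The subordinated integrand is integrable on `(0, ∞)`: `s ↦ s^{-γ} λ e^{-(τ+s)λ}` for `λ > 0`,
`γ < 1`. [folklore] -/
theorem integrableOn_rpow_neg_mul_exp {γ : ℝ} (hγ1 : γ < 1) {lam : ℝ} (hlam : 0 < lam) (τ : ℝ) :
    IntegrableOn (fun s : ℝ => s ^ (-γ) * (lam * Real.exp (-((τ + s) * lam)))) (Ioi 0) := by
  have h := integrableOn_rpow_mul_exp_neg_mul_rpow (s := -γ) (p := 1) (b := lam) (by linarith) le_rfl hlam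
  have h2 : IntegrableOn (fun s : ℝ => (lam * Real.exp (-(τ * lam))) * (s ^ (-γ) * Real.exp (-lam * s ^ (1 : ℝ))))
      (Ioi 0) := h.const_mul _
  refine h2.congr_fun (fun s _ => ?_) measurableSet_Ioi
  simp only [Real.rpow_one]
  rw [show -((τ + s) * lam) = -(τ * lam) + -lam * s by ring, Real.exp_add]
  ring

omit [DecidableEq d] in
/-- **Subordination of the modes**: for `λ ≥ 0`, `τ > 0`, `0 < γ < 1`,
`e^{-τλ} λ^γ = Γ(1-γ)⁻¹ ∫₀^∞ s^{-γ} λ e^{-(τ+s)λ} ds` (both sides vanish at `λ = 0`). [folklore] -/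
theorem exp_mul_rpow_eq_integral {γ : ℝ} (hγ0 : 0 < γ) (hγ1 : γ < 1) {lam : ℝ} (hlam : 0 ≤ lam)
    {τ : ℝ} :
    Real.exp (-(τ * lam)) * lam ^ γ =
      (Real.Gamma (1 - γ))⁻¹ * ∫ s in Ioi (0 : ℝ), s ^ (-γ) * (lam * Real.exp (-((τ + s) * lam))) := by
  rcases hlam.eq_or_lt with h0 | hpos
  · rw [← h0, Real.zero_rpow hγ0.ne']
    simp
  have hΓ : 0 < Real.Gamma (1 - γ) := Real.Gamma_pos_of_pos (by linarith)
  have h1 : ∀ s : ℝ, s ^ (-γ) * (lam * Real.exp (-((τ + s) * lam))) =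
      Real.exp (-(τ * lam)) * (s ^ (-γ) * (lam * Real.exp (-(lam * s)))) := fun s => by
    rw [show -((τ + s) * lam) = -(τ * lam) + -(lam * s) by ring, Real.exp_add]
    ring
  simp_rw [h1]
  rw [integral_const_mul, integral_rpow_neg_mul_exp hγ1 hpos]
  field_simp

omit [DecidableEq d] in
/-- **The elementary integral** `∫₀^∞ s^{-γ} (τ+s)^{-1} ds ≤ (1/(1-γ) + 1/γ) τ^{-γ}` for `τ > 0`,
`0 < γ < 1`, with integrability (split at `s = τ`: `s^{-γ}τ^{-1}` below, `s^{-γ-1}` above). [folklore] -/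
theorem integral_rpow_neg_mul_inv_add_le {γ : ℝ} (hγ0 : 0 < γ) (hγ1 : γ < 1) {τ : ℝ} (hτ : 0 < τ) :
    IntegrableOn (fun s : ℝ => s ^ (-γ) * (τ + s)⁻¹) (Ioi 0) ∧
      ∫ s in Ioi (0 : ℝ), s ^ (-γ) * (τ + s)⁻¹ ≤ (1 / (1 - γ) + 1 / γ) * τ ^ (-γ) := by
  have hmeas : ∀ S : Set ℝ, S ⊆ Ioi 0 → MeasurableSet S →
      AEStronglyMeasurable (fun s : ℝ => s ^ (-γ) * (τ + s)⁻¹) (volume.restrict S) := by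
    intro S hS hSm
    refine (ContinuousOn.mul (fun s hs => ?_) (fun s hs => ?_)).aestronglyMeasurable hSm
    · exact (Real.continuousAt_rpow_const _ _ (Or.inl (hS hs).ne')).continuousWithinAt
    · have : 0 < τ + s := by have := hS hs; rw [mem_Ioi] at this; linarith
      exact ((continuous_const.add continuous_id).continuousAt.inv₀ this.ne').continuousWithinAt
  -- the piece `(0, τ]`
  have hlow_int : IntegrableOn (fun s : ℝ => s ^ (-γ)) (Ioc 0 τ) :=
    (intervalIntegrable_iff_integrableOn_Ioc_of_le hτ.le).1
      (intervalIntegral.intervalIntegrable_rpow' (by linarith))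
  have hlow_le : ∀ s ∈ Ioc (0 : ℝ) τ, ‖s ^ (-γ) * (τ + s)⁻¹‖ ≤ τ⁻¹ * s ^ (-γ) := by
    intro s hs
    have hs0 : 0 < s := hs.1
    have hpow : 0 ≤ s ^ (-γ) := Real.rpow_nonneg hs0.le _
    rw [Real.norm_of_nonneg (mul_nonneg hpow (inv_nonneg.2 (by linarith))), mul_comm]
    refine mul_le_mul_of_nonneg_right ?_ hpow
    exact inv_anti₀ hτ (by linarith)
  have hlow : IntegrableOn (fun s : ℝ => s ^ (-γ) * (τ + s)⁻¹) (Ioc 0 τ) :=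
    (hlow_int.const_mul τ⁻¹).mono' (hmeas _ Ioc_subset_Ioi_self measurableSet_Ioc)
      ((ae_restrict_iff' measurableSet_Ioc).2 (Eventually.of_forall hlow_le))
  -- the piece `(τ, ∞)`
  have hup_int : IntegrableOn (fun s : ℝ => s ^ (-γ - 1)) (Ioi τ) :=
    integrableOn_Ioi_rpow_of_lt (by linarith) hτ
  have hup_le : ∀ s ∈ Ioi τ, ‖s ^ (-γ) * (τ + s)⁻¹‖ ≤ s ^ (-γ - 1) := by
    intro s hs
    rw [mem_Ioi] at hs
    have hs0 : 0 < s := hτ.trans hs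
    have hpow : 0 ≤ s ^ (-γ) := Real.rpow_nonneg hs0.le _
    rw [Real.norm_of_nonneg (mul_nonneg hpow (inv_nonneg.2 (by linarith))), Real.rpow_sub hs0,
      Real.rpow_one, div_eq_mul_inv]
    refine mul_le_mul_of_nonneg_left ?_ hpow
    exact inv_anti₀ hs0 (by linarith)
  have hup : IntegrableOn (fun s : ℝ => s ^ (-γ) * (τ + s)⁻¹) (Ioi τ) :=
    hup_int.mono' (hmeas _ (Ioi_subset_Ioi hτ.le) measurableSet_Ioi)
      ((ae_restrict_iff' measurableSet_Ioi).2 (Eventually.of_forall hup_le))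
  have hunion : Ioc 0 τ ∪ Ioi τ = Ioi 0 := Ioc_union_Ioi_eq_Ioi hτ.le
  refine ⟨by rw [← hunion]; exact hlow.union hup, ?_⟩
  rw [← hunion, setIntegral_union (Set.Ioc_disjoint_Ioi_same) measurableSet_Ioi hlow hup]
  have h1 : ∫ s in Ioc 0 τ, s ^ (-γ) * (τ + s)⁻¹ ≤ 1 / (1 - γ) * τ ^ (-γ) := by
    calc ∫ s in Ioc 0 τ, s ^ (-γ) * (τ + s)⁻¹ ≤ ∫ s in Ioc 0 τ, τ⁻¹ * s ^ (-γ) :=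
          setIntegral_mono_on hlow (hlow_int.const_mul _) measurableSet_Ioc fun s hs =>
            (le_abs_self _).trans ((Real.norm_eq_abs _).symm.trans_le (hlow_le s hs))
      _ = τ⁻¹ * (τ ^ (-γ + 1) / (-γ + 1)) := by
          rw [integral_const_mul, ← intervalIntegral.integral_of_le hτ.le, integral_rpow
            (Or.inl (by linarith)), Real.zero_rpow (by linarith), sub_zero]
      _ = 1 / (1 - γ) * τ ^ (-γ) := by
          rw [Real.rpow_add hτ, Real.rpow_one]
          field_simp
          ring
  have h2 : ∫ s in Ioi τ, s ^ (-γ) * (τ + s)⁻¹ ≤ 1 / γ * τ ^ (-γ) := by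
    calc ∫ s in Ioi τ, s ^ (-γ) * (τ + s)⁻¹ ≤ ∫ s in Ioi τ, s ^ (-γ - 1) :=
          setIntegral_mono_on hup hup_int measurableSet_Ioi fun s hs =>
            (le_abs_self _).trans ((Real.norm_eq_abs _).symm.trans_le (hup_le s hs))
      _ = -τ ^ (-γ - 1 + 1) / (-γ - 1 + 1) := integral_Ioi_rpow_of_lt (by linarith) hτ
      _ = 1 / γ * τ ^ (-γ) := by
          rw [show -γ - 1 + 1 = -γ by ring]
          field_simp
  calc (∫ s in Ioc 0 τ, s ^ (-γ) * (τ + s)⁻¹) + ∫ s in Ioi τ, s ^ (-γ) * (τ + s)⁻¹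
      ≤ 1 / (1 - γ) * τ ^ (-γ) + 1 / γ * τ ^ (-γ) := add_le_add h1 h2
    _ = (1 / (1 - γ) + 1 / γ) * τ ^ (-γ) := by ring

/-! ## Second-order smoothing: the heat flow of a lifted Laplacian -/

/-- **Second-order smoothing bound, bounded data**: for a smooth torus function `g` with
`‖g‖ ≤ B` and `σ > 0`, `‖e^{σΔ} (Δg)~ (x)‖ ≤ #d (2^{n/2} (σ/2)^{-1/2})² B` (two smoothing steps
through `e^{σΔ} = e^{(σ/2)Δ} e^{(σ/2)Δ}`, summed over `Δ = ∑ᵢ ∂ᵢ∂ᵢ`). [cite: GigaGigaSaal2010, §1.1.3] -/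
theorem norm_heatExtension_lift_laplacian_le_of_bound {F : Type*} [NormedAddCommGroup F]
    [NormedSpace ℝ F] [CompleteSpace F] {g : UnitAddTorus d → F} (hg : FunctionSpaces.Torus.IsSmooth g)
    {B : ℝ} (hB : ∀ z, ‖g z‖ ≤ B) {σ : ℝ} (hσ : 0 < σ) (x : EuclideanSpace ℝ d) :
    ‖heatExtension (FunctionSpaces.Torus.lift (FunctionSpaces.Torus.laplacian g)) σ x‖ ≤
      (Fintype.card d : ℝ) * ((2 : ℝ) ^ ((Module.finrank ℝ (EuclideanSpace ℝ d) : ℝ) / 2) *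
        (σ / 2) ^ (-(1 / 2 : ℝ))) ^ 2 * B := by
  set c : ℝ := (2 : ℝ) ^ ((Module.finrank ℝ (EuclideanSpace ℝ d) : ℝ) / 2) with hc
  set e : d → EuclideanSpace ℝ d := fun i => EuclideanSpace.single i (1 : ℝ) with he_def
  have he : ∀ i, ‖e i‖ = 1 := fun i => by simp [he_def]
  have hσ2 : 0 < σ / 2 := by positivity
  -- `Δ g = ∑ᵢ ∂ᵢ∂ᵢ g`, lifted
  set P : d → UnitAddTorus d → F := fun i z =>
    FunctionSpaces.Torus.lineDeriv (fun z' => FunctionSpaces.Torus.lineDeriv g z' (e i)) z (e i) with hP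
  have hPs : ∀ i, FunctionSpaces.Torus.IsSmooth (P i) := fun i => (hg.lineDeriv (e i)).lineDeriv (e i)
  have hlap : FunctionSpaces.Torus.lift (FunctionSpaces.Torus.laplacian g) =
      fun z => ∑ i, FunctionSpaces.Torus.lift (P i) z := by
    funext z
    rw [FunctionSpaces.Torus.lift_apply, FunctionSpaces.Torus.laplacian_eq_sum_partialDeriv_partialDeriv hg]
    rfl
  rw [hlap, heatExtension_sum_lift (fun i => (hPs i).continuous) hσ x]
  have hterm : ∀ i, ‖heatExtension (FunctionSpaces.Torus.lift (P i)) σ x‖ ≤ (c * (σ / 2) ^ (-(1 / 2 : ℝ))) ^ 2 * B := by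
    intro i
    have h1 : ∀ y, ‖heatExtension (FunctionSpaces.Torus.lift
        (fun z' => FunctionSpaces.Torus.lineDeriv g z' (e i))) (σ / 2) y‖ ≤ c * (σ / 2) ^ (-(1 / 2 : ℝ)) * B * ‖e i‖ :=
      fun y => TorusHeat.norm_heatExtension_lift_lineDeriv_le_of_bound hg hB hσ2 y (e i)
    have h2 := TorusHeat.norm_heatExtension_lift_lineDeriv_le_step (hg.lineDeriv (e i)) hσ2 hσ2 h1 x (e i)
    rw [add_halves] at h2
    refine h2.trans (le_of_eq ?_)
    rw [he]
    ring
  calc ‖∑ i, heatExtension (FunctionSpaces.Torus.lift (P i)) σ x‖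
      ≤ ∑ i, ‖heatExtension (FunctionSpaces.Torus.lift (P i)) σ x‖ := norm_sum_le _ _
    _ ≤ ∑ _i : d, (c * (σ / 2) ^ (-(1 / 2 : ℝ))) ^ 2 * B := Finset.sum_le_sum fun i _ => hterm i
    _ = (Fintype.card d : ℝ) * (c * (σ / 2) ^ (-(1 / 2 : ℝ))) ^ 2 * B := by
        simp only [Finset.sum_const, Finset.card_univ, nsmul_eq_mul]
        ring

omit [DecidableEq d] in
/-- The constant of the second-order bound as a multiple of `σ⁻¹`:
`#d (2^{n/2} (σ/2)^{-1/2})² = (2 #d (2^{n/2})²) σ⁻¹`. [folklore] -/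
theorem card_mul_sq_eq {σ : ℝ} (hσ : 0 < σ) :
    (Fintype.card d : ℝ) * ((2 : ℝ) ^ ((Module.finrank ℝ (EuclideanSpace ℝ d) : ℝ) / 2) *
        (σ / 2) ^ (-(1 / 2 : ℝ))) ^ 2 =
      (2 * (Fintype.card d : ℝ) * ((2 : ℝ) ^ ((Module.finrank ℝ (EuclideanSpace ℝ d) : ℝ) / 2)) ^ 2) * σ⁻¹ := by
  have hσ2 : 0 < σ / 2 := by positivity
  have h : ((σ / 2) ^ (-(1 / 2 : ℝ))) ^ 2 = (σ / 2)⁻¹ := by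
    rw [← Real.rpow_natCast, ← Real.rpow_mul hσ2.le,
      show (-(1 / 2 : ℝ)) * ((2 : ℕ) : ℝ) = -1 by norm_num, Real.rpow_neg_one]
  rw [mul_pow, h, inv_div]
  field_simp

/-! ## The heat flow of the fractional Laplacian: the sup bound `‖e^{τΔ}((-Δ)^γ a)~‖ ≲ τ^{-γ}‖a‖₀` -/

/-- **Sup bound for the mollified fractional Laplacian.** For `0 < γ < 1` there is `K = K(γ, d)`
such that for every smooth real field `a` on `T^d` with `‖a‖ ≤ B`, every `τ > 0` and `x ∈ ℝ^d`,
`‖e^{τΔ} ((-Δ)^γ a)~ (x)‖ ≤ K B τ^{-γ}`. Proof: in Fourier modes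
`e^{τΔ}(-Δ)^γ a = ∑ₖ e^{-τλ_k} λ_k^γ e_k â(k)` (`λ_k = 4π²|k|²`), and by Euler's integral
`e^{-τλ} λ^γ = Γ(1-γ)⁻¹ ∫₀^∞ s^{-γ} λ e^{-(τ+s)λ} ds`; summing under the integral sign
(absolute convergence) gives the subordination formula
`e^{τΔ}(-Δ)^γ a = Γ(1-γ)⁻¹ ∫₀^∞ s^{-γ} e^{(τ+s)Δ}(-Δa) ds`, and the second-order smoothing bound
`‖e^{σΔ}(Δa)~‖ ≤ C_Δ σ⁻¹ ‖a‖₀` with `∫₀^∞ s^{-γ}(τ+s)⁻¹ ds ≤ (1/(1-γ) + 1/γ) τ^{-γ}` concludes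
(the classical bound `‖(-Δ)^γ e^{τΔ}‖_{L^∞ → L^∞} ≲ τ^{-γ}` for the heat semigroup on `𝕋ⁿ`).
[folklore] -/
theorem exists_norm_heatExtension_lift_fracLaplacian_le (d : Type*) [Fintype d] [DecidableEq d]
    {γ : ℝ} (hγ0 : 0 < γ) (hγ1 : γ < 1) :
    ∃ K : ℝ, 0 ≤ K ∧ ∀ {a : UnitAddTorus d → EuclideanSpace ℝ d} (_ha : FunctionSpaces.Torus.IsSmooth a)
      {B : ℝ} (_hB : ∀ z, ‖a z‖ ≤ B) {τ : ℝ} (_hτ : 0 < τ) (x : EuclideanSpace ℝ d),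
      ‖heatExtension (FunctionSpaces.Torus.lift (fracLaplacian γ a)) τ x‖ ≤ K * B * τ ^ (-γ) := by
  set c : ℝ := (2 : ℝ) ^ ((Module.finrank ℝ (EuclideanSpace ℝ d) : ℝ) / 2) with hc
  set CΔ : ℝ := 2 * (Fintype.card d : ℝ) * c ^ 2 with hCΔ
  have hΓ : 0 < Real.Gamma (1 - γ) := Real.Gamma_pos_of_pos (by linarith)
  set K : ℝ := (Real.Gamma (1 - γ))⁻¹ * CΔ * (1 / (1 - γ) + 1 / γ) with hK
  have hK0 : 0 ≤ K := by
    have : 0 < 1 - γ := by linarith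
    positivity
  refine ⟨K, hK0, ?_⟩
  intro a ha B hB τ hτ x
  have hB0 : 0 ≤ B := (norm_nonneg _).trans (hB 0)
  -- notation: coefficients, eigenvalues, modes
  set ah : (d → ℤ) → EuclideanSpace ℂ d := fun k => mFourierCoeff (EuclideanSpace.complexify ∘ a) k
    with hah
  set lam : (d → ℤ) → ℝ := fun k => 4 * π ^ 2 * FunctionSpaces.Torus.freqNormSq k with hlam
  have hlam0 : ∀ k, 0 ≤ lam k := fun k => by
    have := FunctionSpaces.Torus.freqNormSq_nonneg k
    simp only [hlam]; positivity
  set v : (d → ℤ) → EuclideanSpace ℂ d := fun k => mFourier k (FunctionSpaces.Torus.proj x) • ah k with hv_def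
  have hv : ∀ k, ‖v k‖ = ‖ah k‖ := fun k => by
    simp only [hv_def]; rw [norm_smul, FunctionSpaces.Torus.norm_mFourier_apply, one_mul]
  -- the scalar weights and the modes `f k s`
  set g : (d → ℤ) → ℝ → ℝ := fun k s => s ^ (-γ) * (lam k * Real.exp (-((τ + s) * lam k))) with hg_def
  set f : (d → ℤ) → ℝ → EuclideanSpace ℂ d := fun k s => ((g k s : ℝ) : ℂ) • v k with hf_def
  have hg_nonneg : ∀ k, ∀ s ∈ Ioi (0 : ℝ), 0 ≤ g k s := fun k s hs => by
    simp only [hg_def]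
    exact mul_nonneg (Real.rpow_nonneg (le_of_lt hs) _) (mul_nonneg (hlam0 k) (Real.exp_pos _).le)
  -- Step 1: the mollified fractional Laplacian in modes, subordinated
  have hE : EuclideanSpace.complexify (heatExtension (FunctionSpaces.Torus.lift (fracLaplacian γ a)) τ x) =
      ((Real.Gamma (1 - γ))⁻¹ : ℂ) • ∑' k : d → ℤ, ∫ s in Ioi (0 : ℝ), f k s := by
    rw [← (hasSum_heatExtension_lift_fracLaplacian hγ0.le ha hτ x).tsum_eq, ← tsum_const_smul'']
    refine tsum_congr fun k => ?_
    have hI : ∫ s in Ioi (0 : ℝ), f k s = ((∫ s in Ioi (0 : ℝ), g k s : ℝ) : ℂ) • v k := by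
      simp only [hf_def]
      rw [integral_smul_const, integral_complex_ofReal]
    have hsub := exp_mul_rpow_eq_integral hγ0 hγ1 (hlam0 k) (τ := τ)
    rw [hI]
    conv_rhs => rw [smul_smul, ← Complex.ofReal_inv, ← Complex.ofReal_mul, ← hsub]
    have hscal : Real.exp (-(4 * π ^ 2 * τ * FunctionSpaces.Torus.freqNormSq k)) * fracSymbol γ k =
        Real.exp (-(τ * lam k)) * lam k ^ γ := by
      simp only [hlam, fracSymbol]
      ring_nf
    rw [hscal]
  -- Step 2: integrability of the modes and summability of their `L¹` norms
  have hf_int : ∀ k, Integrable (f k) (volume.restrict (Ioi (0 : ℝ))) := by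
    intro k
    rcases (hlam0 k).eq_or_lt with h0 | hpos
    · have : f k = fun _ => 0 := by
        funext s
        simp only [hf_def, hg_def, ← h0, zero_mul, mul_zero, Complex.ofReal_zero, zero_smul]
      rw [this]
      exact integrable_zero _ _ _
    · exact ((integrableOn_rpow_neg_mul_exp hγ1 hpos τ).ofReal (𝕜 := ℂ)).smul_const (v k)
  have hf_l1 : ∀ k, ∫ s in Ioi (0 : ℝ), ‖f k s‖ =
      Real.Gamma (1 - γ) * (Real.exp (-(τ * lam k)) * lam k ^ γ) * ‖ah k‖ := by
    intro k
    have h1 : ∫ s in Ioi (0 : ℝ), ‖f k s‖ = ∫ s in Ioi (0 : ℝ), g k s * ‖ah k‖ := by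
      refine setIntegral_congr_fun measurableSet_Ioi fun s hs => ?_
      simp only [hf_def]
      rw [norm_smul, Complex.norm_real, Real.norm_of_nonneg (hg_nonneg k s hs), hv]
    rw [h1, integral_mul_const, exp_mul_rpow_eq_integral hγ0 hγ1 (hlam0 k) (τ := τ),
      ← mul_assoc (Real.Gamma (1 - γ)), mul_inv_cancel₀ hΓ.ne', one_mul]
  have hf_sum : Summable fun k => ∫ s in Ioi (0 : ℝ), ‖f k s‖ := by
    simp_rw [hf_l1]
    refine Summable.of_nonneg_of_le (fun k => ?_) (fun k => ?_)
      ((summable_fracSymbol_mul_norm hγ0.le ha).mul_left (Real.Gamma (1 - γ)))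
    · exact mul_nonneg (mul_nonneg hΓ.le (mul_nonneg (Real.exp_pos _).le (Real.rpow_nonneg (hlam0 k) _)))
        (norm_nonneg _)
    · rw [mul_assoc]
      refine mul_le_mul_of_nonneg_left (mul_le_mul_of_nonneg_right ?_ (norm_nonneg _)) hΓ.le
      calc Real.exp (-(τ * lam k)) * lam k ^ γ ≤ 1 * lam k ^ γ :=
            mul_le_mul_of_nonneg_right (Real.exp_le_one_iff.2 (by
              have := hlam0 k; nlinarith)) (Real.rpow_nonneg (hlam0 k) _)
        _ = fracSymbol γ k := by rw [one_mul]; rfl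
  have hswap : ∑' k : d → ℤ, ∫ s in Ioi (0 : ℝ), f k s = ∫ s in Ioi (0 : ℝ), ∑' k : d → ℤ, f k s :=
    integral_tsum_of_summable_integral_norm hf_int hf_sum
  -- Step 3: the summed modes are `s^{-γ}` times the heat flow of `-Δa` at time `τ + s`
  have hpt : ∀ s ∈ Ioi (0 : ℝ), ‖∑' k : d → ℤ, f k s‖ ≤ s ^ (-γ) * (τ + s)⁻¹ * (CΔ * B) := by
    intro s hs
    have hτs : 0 < τ + s := by rw [mem_Ioi] at hs; linarith
    have hL := (hasSum_heatExtension_lift_laplacian ha hτs x).neg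
    simp only [neg_neg] at hL
    have hfs : ∀ k, f k s = ((s ^ (-γ) : ℝ) : ℂ) •
        ((((Real.exp (-(4 * π ^ 2 * (τ + s) * FunctionSpaces.Torus.freqNormSq k)) *
          (4 * π ^ 2 * FunctionSpaces.Torus.freqNormSq k) : ℝ)) : ℂ) • v k) := by
      intro k
      simp only [hf_def, hg_def, smul_smul, ← Complex.ofReal_mul]
      congr 2
      simp only [hlam]
      rw [mul_comm (4 * π ^ 2 * FunctionSpaces.Torus.freqNormSq k) (Real.exp _)]
      congr 3
      ring
    have htsum : ∑' k : d → ℤ, f k s = ((s ^ (-γ) : ℝ) : ℂ) •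
        -EuclideanSpace.complexify (heatExtension (FunctionSpaces.Torus.lift
          (FunctionSpaces.Torus.laplacian a)) (τ + s) x) := by
      simp_rw [hfs]
      rw [tsum_const_smul'', hL.tsum_eq]
    rw [htsum, norm_smul, Complex.norm_real, Real.norm_of_nonneg (Real.rpow_nonneg (le_of_lt hs) _),
      norm_neg, EuclideanSpace.norm_complexify, mul_assoc]
    refine mul_le_mul_of_nonneg_left ?_ (Real.rpow_nonneg (le_of_lt hs) _)
    have hΔ := norm_heatExtension_lift_laplacian_le_of_bound ha hB hτs x
    rw [card_mul_sq_eq hτs] at hΔ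
    refine hΔ.trans (le_of_eq ?_)
    simp only [hCΔ, hc]
    ring
  -- Step 4: assemble
  obtain ⟨hJi, hJ⟩ := integral_rpow_neg_mul_inv_add_le hγ0 hγ1 hτ
  have hnorm : ‖∫ s in Ioi (0 : ℝ), ∑' k : d → ℤ, f k s‖ ≤ (1 / (1 - γ) + 1 / γ) * τ ^ (-γ) * (CΔ * B) := by
    calc ‖∫ s in Ioi (0 : ℝ), ∑' k : d → ℤ, f k s‖ ≤ ∫ s in Ioi (0 : ℝ), ‖∑' k : d → ℤ, f k s‖ :=
          norm_integral_le_integral_norm _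
      _ ≤ ∫ s in Ioi (0 : ℝ), s ^ (-γ) * (τ + s)⁻¹ * (CΔ * B) := by
          refine integral_mono_of_nonneg (Eventually.of_forall fun s => norm_nonneg _)
            (hJi.mul_const _) ?_
          exact (ae_restrict_iff' measurableSet_Ioi).2 (Eventually.of_forall hpt)
      _ = (∫ s in Ioi (0 : ℝ), s ^ (-γ) * (τ + s)⁻¹) * (CΔ * B) := integral_mul_const _ _
      _ ≤ (1 / (1 - γ) + 1 / γ) * τ ^ (-γ) * (CΔ * B) :=
          mul_le_mul_of_nonneg_right hJ (by positivity)
  calc ‖heatExtension (FunctionSpaces.Torus.lift (fracLaplacian γ a)) τ x‖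
      = ‖EuclideanSpace.complexify (heatExtension (FunctionSpaces.Torus.lift (fracLaplacian γ a)) τ x)‖ :=
        (EuclideanSpace.norm_complexify _).symm
    _ = (Real.Gamma (1 - γ))⁻¹ * ‖∫ s in Ioi (0 : ℝ), ∑' k : d → ℤ, f k s‖ := by
        rw [hE, hswap, norm_smul, ← Complex.ofReal_inv, Complex.norm_real, Real.norm_of_nonneg (inv_nonneg.2 hΓ.le)]
    _ ≤ (Real.Gamma (1 - γ))⁻¹ * ((1 / (1 - γ) + 1 / γ) * τ ^ (-γ) * (CΔ * B)) :=
        mul_le_mul_of_nonneg_left hnorm (inv_nonneg.2 hΓ.le)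
    _ = K * B * τ ^ (-γ) := by simp only [hK]; ring

/-! ## `(-Δ)^θ` preserves incompressibility -/

/-- **`(-Δ)^θ` of a smooth divergence-free field is divergence free** (`θ ≥ 0`): in Fourier
variables `𝓕(div (-Δ)^θ a)(k) = 2πi (4π²|k|²)^θ ∑ⱼ kⱼ â(k)ⱼ = 0` (Grafakos 2014, Prop. 3.2.6 (8);
the coefficients of a smooth divergence-free field are transversal), and a continuous function
with vanishing coefficients vanishes. [folklore] -/
theorem isDivFree_fracLaplacian {θ : ℝ} (hθ : 0 ≤ θ) {a : UnitAddTorus d → EuclideanSpace ℝ d}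
    (ha : FunctionSpaces.Torus.IsSmooth a) (hdiv : FunctionSpaces.Torus.IsDivFree a) :
    FunctionSpaces.Torus.IsDivFree (fracLaplacian θ a) := by
  have hF : FunctionSpaces.Torus.IsSmooth (fracLaplacian θ a) := ha.fracLaplacian hθ
  set h : UnitAddTorus d → ℂ := fun x => (FunctionSpaces.Torus.divergence (fracLaplacian θ a) x : ℂ)
    with hh_def
  have hcont : Continuous h := Complex.continuous_ofReal.comp hF.divergence.continuous
  have hcoef : ∀ k, mFourierCoeff h k = 0 := by
    intro k
    have hcoord : ∀ j : d, mFourierCoeff (EuclideanSpace.complexify ∘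
        FunctionSpaces.Torus.partialDeriv j (fracLaplacian θ a)) k j =
        mFourierCoeff (fun x => ((FunctionSpaces.Torus.partialDeriv j
          (fun y => fracLaplacian θ a y j) x : ℝ) : ℂ)) k := by
      intro j
      rw [FunctionSpaces.Torus.mFourierCoeff_complexify_apply (hF.partialDeriv j).integrable]
      congr 1
      funext x
      have h := FunctionSpaces.Torus.partialDeriv_clm_comp hF
        (EuclideanSpace.proj j : EuclideanSpace ℝ d →L[ℝ] ℝ) j x
      exact congrArg (fun r : ℝ => (r : ℂ)) h.symm
    have hsplit : mFourierCoeff h k = ∑ j, mFourierCoeff (fun x => ((FunctionSpaces.Torus.partialDeriv j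
        (fun y => fracLaplacian θ a y j) x : ℝ) : ℂ)) k := by
      simp only [hh_def, FunctionSpaces.Torus.divergence, Complex.ofReal_sum,
        FunctionSpaces.Torus.mFourierCoeff_eq_integral_volume, Finset.smul_sum]
      exact integral_finsetSum _ fun j _ => FunctionSpaces.Torus.integrable_mFourier_smul'
        (Complex.ofRealCLM.integrable_comp ((hF.apply j).partialDeriv j).integrable) k
    have hterm : ∀ j : d, mFourierCoeff (fun x => ((FunctionSpaces.Torus.partialDeriv j
        (fun y => fracLaplacian θ a y j) x : ℝ) : ℂ)) k =
        2 * Real.pi * Complex.I * (k j : ℂ) *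
          (((fracSymbol θ k : ℝ) : ℂ) * mFourierCoeff (EuclideanSpace.complexify ∘ a) k j) := by
      intro j
      rw [← hcoord j, FunctionSpaces.Torus.mFourierCoeff_complexify_partialDeriv hF,
        mFourierCoeff_complexify_fracLaplacian hθ ha, PiLp.smul_apply, PiLp.smul_apply, smul_eq_mul,
        smul_eq_mul]
    rw [hsplit]
    simp_rw [hterm]
    have h0 := hdiv.sum_mul_mFourierCoeff_eq_zero ha k
    calc ∑ j, 2 * Real.pi * Complex.I * (k j : ℂ) *
          (((fracSymbol θ k : ℝ) : ℂ) * mFourierCoeff (EuclideanSpace.complexify ∘ a) k j)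
        = (2 * Real.pi * Complex.I * ((fracSymbol θ k : ℝ) : ℂ)) *
            ∑ j, (k j : ℂ) * mFourierCoeff (EuclideanSpace.complexify ∘ a) k j := by
          rw [Finset.mul_sum]
          refine Finset.sum_congr rfl fun j _ => ?_
          ring
      _ = 0 := by rw [h0, mul_zero]
  have hzero := FunctionSpaces.Torus.eq_zero_of_forall_mFourierCoeff_eq_zero hcont hcoef
  intro x
  have hx := congrFun hzero x
  simpa [hh_def] using hx

/-! ## The fractional Navier–Stokes–Reynolds system lifted to `ℝ^d`: pressure equation and `∂ₜv` -/

section Pressure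

variable {S : Set ℝ} {θ ν : ℝ} {v : ℝ → UnitAddTorus d → EuclideanSpace ℝ d} {p : ℝ → UnitAddTorus d → ℝ}
  {R : ℝ → UnitAddTorus d → d → EuclideanSpace ℝ d}

/-- **Torus-to-space bridge for the fractional Navier–Stokes–Reynolds system.** The periodic lift
of a classical solution of `∂ₜv + div(v ⊗ v) + ∇p + ν(-Δ)^θ v = div R` on `T^d × S` is a classical
(periodic) solution of the incompressible Euler equations on `ℝ^d × S` (`IsClassicalNSSolutionOn`
with viscosity `0`) forced by `f = (div R)~ - ν((-Δ)^θ v)~`. [cite: LuoTiti2020, §2.1 (2.1)] -/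
theorem IsFracNSReynoldsOn.isClassicalNSSolutionOn_lift (h : IsFracNSReynoldsOn S θ ν v p R) :
    IsClassicalNSSolutionOn S 0
      (fun t y => FunctionSpaces.Torus.lift (tensorDivergence (R t)) y -
        ν • FunctionSpaces.Torus.lift (fracLaplacian θ (v t)) y)
      (fun t => FunctionSpaces.Torus.lift (v t)) (fun t => FunctionSpaces.Torus.lift (p t)) where
  smooth_velocity := isSmoothSpaceTimeOn_iff_torus.2 h.smooth_velocity
  smooth_pressure := isSmoothSpaceTimeOn_iff_torus.2 h.smooth_pressure
  momentum t ht y := by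
    have hm := h.momentum t ht (FunctionSpaces.Torus.proj y)
    rw [timeDerivWithin_lift, ← lift_convect, ← lift_gradient_eq]
    simp only [FunctionSpaces.Torus.lift_apply, zero_smul, zero_sub]
    rw [← hm]
    abel
  divFree t ht := (FunctionSpaces.Torus.isDivFree_iff_trace_fderiv_lift
    ((h.smooth_velocity.isSmooth_slice ht).isContDiff (by simp))).1 (h.divFree t ht)

/-- **The pressure equation of the fractional Navier–Stokes–Reynolds system, lifted to `ℝ^d`.**
At every interior time `t` of `S` and every `y ∈ ℝ^d`,
`Δp̃(t)(y) = Σᵢⱼ ∂ᵢ∂ⱼ (Rⱼᵢ)~ (y) - Σᵢⱼ ∂ᵢ∂ⱼ (vᵢvⱼ)~ (y)` — exactly the Euler–Reynolds pressure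
equation (BDSV 2019, §2.2), since the hypodissipative term is divergence free
(`isDivFree_fracLaplacian`: `div (-Δ)^θ v = (-Δ)^θ div v = 0`). [cite: Derosa2018, §4.2 (proof of Thm. 2.1, time regularity)] -/
theorem IsFracNSReynoldsOn.laplacian_lift_pressure (h : IsFracNSReynoldsOn S θ ν v p R) (hθ : 0 ≤ θ)
    {t : ℝ} (ht : t ∈ interior S) (y : EuclideanSpace ℝ d) :
    (Δ (FunctionSpaces.Torus.lift (p t))) y =
      ∑ i, ∑ j, fderiv ℝ (fun z => fderiv ℝ (FunctionSpaces.Torus.lift (fun x => R t x j i)) z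
          (EuclideanSpace.single j (1 : ℝ))) y (EuclideanSpace.single i (1 : ℝ)) -
      ∑ i, ∑ j, fderiv ℝ (fun z => fderiv ℝ (FunctionSpaces.Torus.lift (fun x => v t x i * v t x j)) z
          (EuclideanSpace.single j (1 : ℝ))) y (EuclideanSpace.single i (1 : ℝ)) := by
  have ht' : t ∈ S := interior_subset ht
  have hv : FunctionSpaces.Torus.IsSmooth (v t) := h.smooth_velocity.isSmooth_slice ht'
  have hR : FunctionSpaces.Torus.IsSmooth (R t) := h.smooth_stress.isSmooth_slice ht'
  have hv2 : ContDiff ℝ 2 (FunctionSpaces.Torus.lift (v t)) := hv.isContDiff (n := 2)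
    (WithTop.coe_le_coe.mpr le_top)
  have hdiv : VectorCalculus.IsDivFree (FunctionSpaces.Torus.lift (v t)) :=
    (FunctionSpaces.Torus.isDivFree_iff_trace_fderiv_lift (hv.isContDiff (by simp))).1 (h.divFree t ht')
  have hF : FunctionSpaces.Torus.IsSmooth (fracLaplacian θ (v t)) := hv.fracLaplacian hθ
  have hdivF : VectorCalculus.IsDivFree (FunctionSpaces.Torus.lift (fracLaplacian θ (v t))) :=
    (FunctionSpaces.Torus.isDivFree_iff_trace_fderiv_lift (hF.isContDiff (by simp))).1
      (isDivFree_fracLaplacian hθ hv (h.divFree t ht'))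
  have hdT : DifferentiableAt ℝ (FunctionSpaces.Torus.lift (tensorDivergence (R t))) y :=
    ((hR.tensorDivergence).isContDiff (n := 1) (by simp)).differentiable one_ne_zero y
  have hdF : DifferentiableAt ℝ (FunctionSpaces.Torus.lift (fracLaplacian θ (v t))) y :=
    (hF.isContDiff (n := 1) (by simp)).differentiable one_ne_zero y
  have hdF' : DifferentiableAt ℝ (fun z => ν • FunctionSpaces.Torus.lift (fracLaplacian θ (v t)) z) y := by
    exact hdF.const_smul ν
  rw [laplacian_pressure_eq_of_isClassicalNSSolutionOn h.isClassicalNSSolutionOn_lift ht y,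
    divergence_convect_eq_sum_sum hv2 hdiv,
    divergence_sub_apply (w := fun z => ν • FunctionSpaces.Torus.lift (fracLaplacian θ (v t)) z) hdT hdF',
    divergence_const_smul_apply hdF, hdivF y, mul_zero, sub_zero, divergence_lift_tensorDivergence hR,
    neg_add_eq_sub]
  rfl

/-- **The momentum equation solved for `∂ₜv`, lifted, in coordinates** (interior times): for
`t ∈ interior S`, `y ∈ ℝ^d` and a coordinate `i`,
`∂ₜṽᵢ(t, y) = Σⱼ ∂ⱼ(Rⱼᵢ)~(y) - ∂ᵢ p̃(t)(y) - Σⱼ ∂ⱼ (vᵢvⱼ)~(y) - ν ((-Δ)^θ v(t))ᵢ(proj y)`.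
[cite: LuoTiti2020, §2.1 (2.1)] -/
theorem IsFracNSReynoldsOn.deriv_lift_velocity_apply (h : IsFracNSReynoldsOn S θ ν v p R) {t : ℝ}
    (ht : t ∈ interior S) (y : EuclideanSpace ℝ d) (i : d) :
    deriv (fun s => FunctionSpaces.Torus.lift (v s) y) t i =
      ∑ j, fderiv ℝ (FunctionSpaces.Torus.lift (fun x => R t x j i)) y (EuclideanSpace.single j (1 : ℝ)) -
      fderiv ℝ (FunctionSpaces.Torus.lift (p t)) y (EuclideanSpace.single i (1 : ℝ)) -
      ∑ j, fderiv ℝ (FunctionSpaces.Torus.lift (fun x => v t x i * v t x j)) y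
        (EuclideanSpace.single j (1 : ℝ)) -
      ν * fracLaplacian θ (v t) (FunctionSpaces.Torus.proj y) i := by
  have ht' : t ∈ S := interior_subset ht
  have hv : FunctionSpaces.Torus.IsSmooth (v t) := h.smooth_velocity.isSmooth_slice ht'
  have hR : FunctionSpaces.Torus.IsSmooth (R t) := h.smooth_stress.isSmooth_slice ht'
  have hm := h.momentum t ht' (FunctionSpaces.Torus.proj y)
  rw [FunctionSpaces.Torus.timeDerivWithin_of_mem_interior ht] at hm
  have hd : deriv (fun s => FunctionSpaces.Torus.lift (v s) y) t =
      FunctionSpaces.Torus.lift (tensorDivergence (R t)) y -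
        FunctionSpaces.Torus.lift (FunctionSpaces.Torus.gradient (p t)) y -
        FunctionSpaces.Torus.lift (FunctionSpaces.Torus.convect (v t) (v t)) y -
        ν • fracLaplacian θ (v t) (FunctionSpaces.Torus.proj y) := by
    simp only [FunctionSpaces.Torus.lift_apply]
    rw [← hm, FunctionSpaces.Torus.timeDeriv]
    abel
  rw [hd, PiLp.sub_apply, PiLp.sub_apply, PiLp.sub_apply, PiLp.smul_apply, lift_tensorDivergence_apply hR,
    lift_gradient_apply, lift_convect_apply_eq_sum hv (h.divFree t ht'), smul_eq_mul]

end Pressure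

/-! ## Bound on the mollified time derivative of a fractional Navier–Stokes–Reynolds velocity -/

/-- **Bound on the mollified time derivative** (De Rosa 2019, §4.2, the display
`‖∂ₜ ṽ_q‖₀ ≤ ‖v⊗v ⋆ ψ‖₁ + ‖∇p ⋆ ψ‖₀ + ‖(-Δ)^γ ṽ‖₀ ≲ 2^{q(1+ε-β')}`, here without the `ε`-loss, with
the Reynolds stress kept and with the heat kernel as mollifier): for a classical solution of the
fractional Navier–Stokes–Reynolds system with exponent `0 < γ < 1` and viscosity `ν` on
`[0,T] × T^d`, an interior time `s`, a velocity slice with `‖v(s)‖ ≤ V` and `r`-Hölder constant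
`C` (`0 < r < 1`), a stress slice with `‖R(s)‖ ≤ ρ`, and `τ > 0`,
`‖e^{τΔ} (∂ₜv(s))~ (x)‖ ≤ K_A VC τ^{(r-1)/2} + K_B ρ τ^{-1/2} + K_C |ν| V τ^{-γ}`,
from `∂ₜv = div R - ∇p - div(v ⊗ v) - ν(-Δ)^γ v`, the pressure equation
`Δp = div div (R - v ⊗ v)` (`IsFracNSReynoldsOn.laplacian_lift_pressure`), the mollification
estimates of `TorusHeatFlow` and the bound `exists_norm_heatExtension_lift_fracLaplacian_le`.
[cite: Derosa2018, §4.2 (proof of Thm. 2.1, time regularity)] -/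
theorem exists_norm_heatExtension_lift_timeDerivWithin_le_frac (d : Type*) [Fintype d] [DecidableEq d]
    {r : ℝ≥0} (hr0 : 0 < r) (hr1 : r < 1) {γ : ℝ} (hγ0 : 0 < γ) (hγ1 : γ < 1) :
    ∃ KA KB KC : ℝ, 0 ≤ KA ∧ 0 ≤ KB ∧ 0 ≤ KC ∧
      ∀ {T ν : ℝ} {v : ℝ → UnitAddTorus d → EuclideanSpace ℝ d} {p : ℝ → UnitAddTorus d → ℝ}
        {R : ℝ → UnitAddTorus d → d → EuclideanSpace ℝ d} (_h : IsFracNSReynoldsOn (Icc 0 T) γ ν v p R)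
        {s : ℝ} (_hs : s ∈ Ioo 0 T) {C : ℝ≥0} (_hH : HolderWith C r (v s))
        {V : ℝ} (_hV : ∀ z, ‖v s z‖ ≤ V) {ρ : ℝ} (_hρ : ∀ z, ‖R s z‖ ≤ ρ) {τ : ℝ} (_hτ : 0 < τ)
        (x : EuclideanSpace ℝ d),
        ‖heatExtension (FunctionSpaces.Torus.lift (FunctionSpaces.Torus.timeDerivWithin (Icc 0 T) v s)) τ x‖ ≤
          KA * (V * C) * τ ^ (((r : ℝ) - 1) / 2) + KB * ρ * τ ^ (-(1 / 2 : ℝ)) +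
            KC * |ν| * V * τ ^ (-γ) := by
  -- the constants
  obtain ⟨KF, KG, hKF, hKG, hP⟩ :=
    TorusHeat.exists_norm_heatExtension_lift_lineDeriv_le_of_laplacian_eq d (β := (r : ℝ))
      (by exact_mod_cast hr0.le) (by exact_mod_cast hr1)
  obtain ⟨Kγ, hKγ, hFrac⟩ := exists_norm_heatExtension_lift_fracLaplacian_le d hγ0 hγ1
  set c : ℝ := (2 : ℝ) ^ ((Module.finrank ℝ (EuclideanSpace ℝ d) : ℝ) / 2) with hc
  set cH : ℝ := (1 + 2 * (2 : ℝ) ^ ((Module.finrank ℝ (EuclideanSpace ℝ d) : ℝ) / 2)) with hcH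
  have hc0 : 0 < c := Real.rpow_pos_of_pos two_pos _
  have hcH0 : 0 < cH := by rw [hcH]; positivity
  set KA : ℝ := 2 * (Fintype.card d : ℝ) * (KG + (Fintype.card d : ℝ) * c * cH * (2 : ℝ) ^ ((r : ℝ) / 2)) with hKA
  set KB : ℝ := (Fintype.card d : ℝ) * ((Fintype.card d : ℝ) * c + KF) with hKB
  set KC : ℝ := (Fintype.card d : ℝ) * Kγ with hKC
  refine ⟨KA, KB, KC, by positivity, by positivity, by positivity, ?_⟩
  intro T ν v p R h s hs C hH V hV ρ hρ τ hτ x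
  have hsI : s ∈ Icc 0 T := Ioo_subset_Icc_self hs
  have hsint : s ∈ interior (Icc 0 T) := by rw [interior_Icc]; exact hs
  have hvs : FunctionSpaces.Torus.IsSmooth (v s) := h.smooth_velocity.isSmooth_slice hsI
  have hps : FunctionSpaces.Torus.IsSmooth (p s) := h.smooth_pressure.isSmooth_slice hsI
  have hRs : FunctionSpaces.Torus.IsSmooth (R s) := h.smooth_stress.isSmooth_slice hsI
  have hLs : FunctionSpaces.Torus.IsSmooth (fracLaplacian γ (v s)) := hvs.fracLaplacian hγ0.le
  have hV0 : 0 ≤ V := (norm_nonneg _).trans (hV 0)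
  have hρ0 : 0 ≤ ρ := (norm_nonneg _).trans (hρ 0)
  set e : d → EuclideanSpace ℝ d := fun i => EuclideanSpace.single i (1 : ℝ) with he_def
  have he : ∀ i, ‖e i‖ = 1 := fun i => by simp [he_def]
  -- the three families of smooth torus functions entering `∂ₜ v`, and the hypodissipative term
  set Fs : d → d → UnitAddTorus d → ℝ := fun i j z => R s z j i with hFs_def
  set Gs : d → d → UnitAddTorus d → ℝ := fun i j z => v s z i * v s z j with hGs_def
  set Ls : d → UnitAddTorus d → ℝ := fun i z => fracLaplacian γ (v s) z i with hLs_def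
  have hFs : ∀ i j, FunctionSpaces.Torus.IsSmooth (Fs i j) := fun i j => (hRs.column j).apply i
  have hGs : ∀ i j, FunctionSpaces.Torus.IsSmooth (Gs i j) := fun i j => by
    have := (hvs.apply i).smul' (hvs.apply j)
    simpa [hGs_def, smul_eq_mul] using this
  have hLsi : ∀ i, FunctionSpaces.Torus.IsSmooth (Ls i) := fun i => hLs.apply i
  have hFb : ∀ i j z, ‖Fs i j z‖ ≤ ρ := fun i j z => by
    simp only [hFs_def, Real.norm_eq_abs]
    exact (FunctionSpaces.Torus.abs_apply_le_norm (R s z j) i).trans ((norm_le_pi_norm (R s z) j).trans (hρ z))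
  have hA : 0 ≤ 2 * V * C := by positivity
  have hGH : ∀ i j y z, ‖FunctionSpaces.Torus.lift (Gs i j) y - FunctionSpaces.Torus.lift (Gs i j) z‖ ≤
      2 * V * C * ‖y - z‖ ^ (r : ℝ) := fun i j y z => abs_lift_mul_sub_le hH hV i j y z
  set D : EuclideanSpace ℝ d → (UnitAddTorus d → ℝ) → UnitAddTorus d → ℝ :=
    fun w g z => FunctionSpaces.Torus.lineDeriv g z w with hD_def
  -- the lifted time derivative, componentwise
  set Ψ := FunctionSpaces.Torus.lift (FunctionSpaces.Torus.timeDerivWithin (Icc 0 T) v s) with hΨ_def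
  have hΨcomp : ∀ i, (fun z => Ψ z i) = fun z =>
      ((∑ j, FunctionSpaces.Torus.lift (D (e j) (Fs i j)) z - FunctionSpaces.Torus.lift (D (e i) (p s)) z) -
        ∑ j, FunctionSpaces.Torus.lift (D (e j) (Gs i j)) z) -
        ν • FunctionSpaces.Torus.lift (Ls i) z := by
    intro i
    funext z
    have hderiv : Ψ z = deriv (fun s' => FunctionSpaces.Torus.lift (v s') z) s := by
      rw [hΨ_def, FunctionSpaces.Torus.lift_apply, FunctionSpaces.Torus.timeDerivWithin_of_mem_interior hsint]
      rfl
    rw [hderiv, h.deriv_lift_velocity_apply hsint z i]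
    simp only [hD_def, ← TorusHeat.fderiv_lift_apply_eq (hFs _ _), ← TorusHeat.fderiv_lift_apply_eq hps,
      ← TorusHeat.fderiv_lift_apply_eq (hGs _ _), smul_eq_mul]
    rfl
  -- continuity of `Ψ` and the componentwise heat flow
  have hΨsm : FunctionSpaces.Torus.IsSmooth (FunctionSpaces.Torus.timeDerivWithin (Icc 0 T) v s) :=
    (h.smooth_velocity.timeDerivWithin (uniqueDiffOn_Icc (hs.1.trans hs.2))).isSmooth_slice hsI
  obtain ⟨CΨ, -, hCΨ⟩ := TorusHeat.exists_norm_lift_le hΨsm.continuous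
  have hcomp : ∀ i, heatExtension Ψ τ x i = heatExtension (fun z => Ψ z i) τ x := fun i => by
    have := heatExtension_clm_comp_of_bound (EuclideanSpace.proj i : EuclideanSpace ℝ d →L[ℝ] ℝ)
      (FunctionSpaces.Torus.continuous_lift_iff.2 hΨsm.continuous) hCΨ hτ x
    exact this.symm
  -- linearity of the heat flow on each component
  have hDs : ∀ {g : UnitAddTorus d → ℝ}, FunctionSpaces.Torus.IsSmooth g → ∀ w,
      FunctionSpaces.Torus.IsSmooth (D w g) := fun hg w => hg.lineDeriv w
  have hlin : ∀ i, heatExtension (fun z => Ψ z i) τ x =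
      ((∑ j, heatExtension (FunctionSpaces.Torus.lift (D (e j) (Fs i j))) τ x -
        heatExtension (FunctionSpaces.Torus.lift (D (e i) (p s))) τ x) -
      ∑ j, heatExtension (FunctionSpaces.Torus.lift (D (e j) (Gs i j))) τ x) -
      ν • heatExtension (FunctionSpaces.Torus.lift (Ls i)) τ x := by
    intro i
    rw [hΨcomp i]
    choose CF _ hCF using fun j => TorusHeat.exists_norm_le (hDs (hFs i j) (e j)).continuous
    choose CG _ hCG using fun j => TorusHeat.exists_norm_le (hDs (hGs i j) (e j)).continuous
    obtain ⟨CP, -, hCP⟩ := TorusHeat.exists_norm_le (hDs hps (e i)).continuous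
    obtain ⟨CL, -, hCL⟩ := TorusHeat.exists_norm_le (hLsi i).continuous
    have hc1 : Continuous fun z : EuclideanSpace ℝ d => ∑ j, FunctionSpaces.Torus.lift (D (e j) (Fs i j)) z :=
      continuous_finsetSum _ fun j _ => FunctionSpaces.Torus.continuous_lift_iff.2 (hDs (hFs i j) (e j)).continuous
    have hc2 : Continuous fun z : EuclideanSpace ℝ d => FunctionSpaces.Torus.lift (D (e i) (p s)) z :=
      FunctionSpaces.Torus.continuous_lift_iff.2 (hDs hps (e i)).continuous
    have hc3 : Continuous fun z : EuclideanSpace ℝ d => ∑ j, FunctionSpaces.Torus.lift (D (e j) (Gs i j)) z :=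
      continuous_finsetSum _ fun j _ => FunctionSpaces.Torus.continuous_lift_iff.2 (hDs (hGs i j) (e j)).continuous
    have hc4 : Continuous fun z : EuclideanSpace ℝ d => ν • FunctionSpaces.Torus.lift (Ls i) z :=
      (FunctionSpaces.Torus.continuous_lift_iff.2 (hLsi i).continuous).const_smul ν
    have hb1 : ∀ z : EuclideanSpace ℝ d, ‖∑ j, FunctionSpaces.Torus.lift (D (e j) (Fs i j)) z‖ ≤ ∑ j, CF j :=
      fun z => (norm_sum_le _ _).trans (Finset.sum_le_sum fun j _ => hCF j _)
    have hb3 : ∀ z : EuclideanSpace ℝ d, ‖∑ j, FunctionSpaces.Torus.lift (D (e j) (Gs i j)) z‖ ≤ ∑ j, CG j :=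
      fun z => (norm_sum_le _ _).trans (Finset.sum_le_sum fun j _ => hCG j _)
    have hb12 : ∀ z : EuclideanSpace ℝ d, ‖∑ j, FunctionSpaces.Torus.lift (D (e j) (Fs i j)) z -
        FunctionSpaces.Torus.lift (D (e i) (p s)) z‖ ≤ ∑ j, CF j + CP :=
      fun z => (norm_sub_le _ _).trans (add_le_add (hb1 z) (hCP _))
    have hb123 : ∀ z : EuclideanSpace ℝ d, ‖(∑ j, FunctionSpaces.Torus.lift (D (e j) (Fs i j)) z -
        FunctionSpaces.Torus.lift (D (e i) (p s)) z) - ∑ j, FunctionSpaces.Torus.lift (D (e j) (Gs i j)) z‖ ≤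
        (∑ j, CF j + CP) + ∑ j, CG j :=
      fun z => (norm_sub_le _ _).trans (add_le_add (hb12 z) (hb3 z))
    have hb4 : ∀ z : EuclideanSpace ℝ d, ‖ν • FunctionSpaces.Torus.lift (Ls i) z‖ ≤ |ν| * CL := fun z => by
      rw [norm_smul, Real.norm_eq_abs]
      exact mul_le_mul_of_nonneg_left (hCL _) (abs_nonneg ν)
    have hc12 : Continuous fun z : EuclideanSpace ℝ d => ∑ j, FunctionSpaces.Torus.lift (D (e j) (Fs i j)) z -
        FunctionSpaces.Torus.lift (D (e i) (p s)) z := hc1.sub hc2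
    have hc123 : Continuous fun z : EuclideanSpace ℝ d => (∑ j, FunctionSpaces.Torus.lift (D (e j) (Fs i j)) z -
        FunctionSpaces.Torus.lift (D (e i) (p s)) z) - ∑ j, FunctionSpaces.Torus.lift (D (e j) (Gs i j)) z :=
      hc12.sub hc3
    rw [heatExtension_sub_of_bound hc123 hc4 hb123 hb4 hτ x,
      heatExtension_sub_of_bound hc12 hc3 hb12 hb3 hτ x,
      heatExtension_sub_of_bound hc1 hc2 hb1 (fun z => hCP _) hτ x,
      heatExtension_sum_lift (fun j => (hDs (hFs i j) (e j)).continuous) hτ x,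
      heatExtension_sum_lift (fun j => (hDs (hGs i j) (e j)).continuous) hτ x,
      heatExtension_const_smul]
  -- the four bounds
  have hbF : ∀ i j, ‖heatExtension (FunctionSpaces.Torus.lift (D (e j) (Fs i j))) τ x‖ ≤
      c * τ ^ (-(1 / 2 : ℝ)) * ρ := fun i j => by
    have := TorusHeat.norm_heatExtension_lift_lineDeriv_le_of_bound (hFs i j) (hFb i j) hτ x (e j)
    rwa [he, mul_one] at this
  have hbP : ∀ i, ‖heatExtension (FunctionSpaces.Torus.lift (D (e i) (p s))) τ x‖ ≤
      KF * ρ * τ ^ (-(1 / 2 : ℝ)) + KG * (2 * V * C) * τ ^ (((r : ℝ) - 1) / 2) := fun i => by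
    have := hP hps hFs hGs hFb hA hGH (h.laplacian_lift_pressure hγ0.le hsint) hτ x (e i)
    rwa [he, mul_one] at this
  have hbG : ∀ i j, ‖heatExtension (FunctionSpaces.Torus.lift (D (e j) (Gs i j))) τ x‖ ≤
      c * τ ^ (-(1 / 2 : ℝ)) * (cH * (2 * τ) ^ ((r : ℝ) / 2)) * (2 * V * C) := fun i j => by
    have := TorusHeat.norm_heatExtension_lift_lineDeriv_le_of_holder (hGs i j) hA (by exact_mod_cast hr0.le)
      (by exact_mod_cast hr1.le) (hGH i j) hτ x (e j)
    rwa [he, mul_one] at this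
  have hbL : ∀ i, ‖ν • heatExtension (FunctionSpaces.Torus.lift (Ls i)) τ x‖ ≤ |ν| * (Kγ * V * τ ^ (-γ)) := by
    intro i
    obtain ⟨CL0, -, hCL0⟩ := TorusHeat.exists_norm_lift_le hLs.continuous
    have hci : heatExtension (FunctionSpaces.Torus.lift (Ls i)) τ x =
        heatExtension (FunctionSpaces.Torus.lift (fracLaplacian γ (v s))) τ x i :=
      heatExtension_clm_comp_of_bound (EuclideanSpace.proj i : EuclideanSpace ℝ d →L[ℝ] ℝ)
        (FunctionSpaces.Torus.continuous_lift_iff.2 hLs.continuous) hCL0 hτ x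
    rw [norm_smul, Real.norm_eq_abs, hci]
    refine mul_le_mul_of_nonneg_left ?_ (abs_nonneg ν)
    exact (FunctionSpaces.Torus.abs_apply_le_norm _ i).trans (hFrac hvs hV hτ x)
  -- assemble
  have hτr : τ ^ (-(1 / 2 : ℝ)) * (2 * τ) ^ ((r : ℝ) / 2) = (2 : ℝ) ^ ((r : ℝ) / 2) * τ ^ (((r : ℝ) - 1) / 2) := by
    rw [Real.mul_rpow (by norm_num) hτ.le, show ((r : ℝ) - 1) / 2 = -(1 / 2 : ℝ) + (r : ℝ) / 2 by ring,
      Real.rpow_add hτ]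
    ring
  calc ‖heatExtension Ψ τ x‖ ≤ ∑ i, |heatExtension Ψ τ x i| := norm_le_sum_abs _
    _ = ∑ i, ‖heatExtension (fun z => Ψ z i) τ x‖ := by
        refine Finset.sum_congr rfl fun i _ => ?_
        rw [hcomp i, Real.norm_eq_abs]
    _ ≤ ∑ _i : d, (((Fintype.card d : ℝ) * (c * τ ^ (-(1 / 2 : ℝ)) * ρ) +
          (KF * ρ * τ ^ (-(1 / 2 : ℝ)) + KG * (2 * V * C) * τ ^ (((r : ℝ) - 1) / 2)) +
          (Fintype.card d : ℝ) * (c * τ ^ (-(1 / 2 : ℝ)) * (cH * (2 * τ) ^ ((r : ℝ) / 2)) * (2 * V * C))) +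
          |ν| * (Kγ * V * τ ^ (-γ))) := by
        refine Finset.sum_le_sum fun i _ => ?_
        rw [hlin i]
        refine (norm_sub_le _ _).trans (add_le_add ?_ (hbL i))
        refine (norm_sub_le _ _).trans (add_le_add ((norm_sub_le _ _).trans (add_le_add ?_ (hbP i))) ?_)
        · refine (norm_sum_le _ _).trans ((Finset.sum_le_sum fun j _ => hbF i j).trans ?_)
          simp
        · refine (norm_sum_le _ _).trans ((Finset.sum_le_sum fun j _ => hbG i j).trans ?_)
          simp
    _ = KA * (V * C) * τ ^ (((r : ℝ) - 1) / 2) + KB * ρ * τ ^ (-(1 / 2 : ℝ)) + KC * |ν| * V * τ ^ (-γ) := by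
        simp only [Finset.sum_const, Finset.card_univ, nsmul_eq_mul, hKA, hKB, hKC]
        rw [show c * τ ^ (-(1 / 2 : ℝ)) * (cH * (2 * τ) ^ ((r : ℝ) / 2)) =
          c * cH * (τ ^ (-(1 / 2 : ℝ)) * (2 * τ) ^ ((r : ℝ) / 2)) by ring, hτr]
        ring

/-! ## The time increment of the velocity before the limit -/

/-- **The time increment of a fractional Navier–Stokes–Reynolds velocity through its caloric
mollification** (De Rosa 2019, §4.2, after BDSV 2019, §2.2: `‖ṽ - v‖₀ ≲ [v]_{β'} ℓ^{β'}` twice plus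
`|t₂ - t₁| ‖∂ₜṽ‖₀`). For interior times `0 < t₁ ≤ t₂ < T`, uniform bounds `‖v‖ ≤ V`,
`[v(t)]_r ≤ C`, `‖R‖ ≤ ρ` on `[0,T]`, every `τ > 0` and every `y ∈ ℝ^d`:
`‖ṽ(t₂,y) - ṽ(t₁,y)‖ ≤ 2 K₀ C τ^{r/2} + (t₂ - t₁)(K_A V C τ^{(r-1)/2} + K_B ρ τ^{-1/2} + K_C |ν| V τ^{-γ})`.
[cite: Derosa2018, §4.2 (proof of Thm. 2.1, time regularity)] -/
theorem exists_norm_lift_sub_lift_le_frac (d : Type*) [Fintype d] [DecidableEq d]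
    {r : ℝ≥0} (hr0 : 0 < r) (hr1 : r < 1) {γ : ℝ} (hγ0 : 0 < γ) (hγ1 : γ < 1) :
    ∃ K₀ KA KB KC : ℝ, 0 ≤ K₀ ∧ 0 ≤ KA ∧ 0 ≤ KB ∧ 0 ≤ KC ∧
      ∀ {T ν : ℝ} {v : ℝ → UnitAddTorus d → EuclideanSpace ℝ d} {p : ℝ → UnitAddTorus d → ℝ}
        {R : ℝ → UnitAddTorus d → d → EuclideanSpace ℝ d} (_h : IsFracNSReynoldsOn (Icc 0 T) γ ν v p R)
        (_hT : 0 < T) {t₁ t₂ : ℝ} (_ht₁ : 0 < t₁) (_ht₁₂ : t₁ ≤ t₂) (_ht₂ : t₂ < T) {C : ℝ≥0}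
        (_hH : ∀ t ∈ Icc 0 T, HolderWith C r (v t)) {V : ℝ} (_hV : ∀ t ∈ Icc 0 T, ∀ z, ‖v t z‖ ≤ V)
        {ρ : ℝ} (_hρ : ∀ t ∈ Icc 0 T, ∀ z, ‖R t z‖ ≤ ρ) {τ : ℝ} (_hτ : 0 < τ) (y : EuclideanSpace ℝ d),
        ‖FunctionSpaces.Torus.lift (v t₂) y - FunctionSpaces.Torus.lift (v t₁) y‖ ≤
          2 * (K₀ * C * τ ^ ((r : ℝ) / 2)) +
            (t₂ - t₁) * (KA * (V * C) * τ ^ (((r : ℝ) - 1) / 2) + KB * ρ * τ ^ (-(1 / 2 : ℝ)) +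
              KC * |ν| * V * τ ^ (-γ)) := by
  obtain ⟨KA, KB, KC, hKA, hKB, hKC, hB⟩ := exists_norm_heatExtension_lift_timeDerivWithin_le_frac d hr0 hr1 hγ0 hγ1
  set K₀ : ℝ := (1 + 2 * (2 : ℝ) ^ ((Module.finrank ℝ (EuclideanSpace ℝ d) : ℝ) / 2)) with hK₀
  refine ⟨K₀, KA, KB, KC, by positivity, hKA, hKB, hKC, ?_⟩
  intro T ν v p R h hT t₁ t₂ ht₁ ht₁₂ ht₂ C hH V hV ρ hρ τ hτ y
  have hI : ∀ t ∈ Icc t₁ t₂, t ∈ Ioo 0 T := fun t ht => ⟨ht₁.trans_le ht.1, ht.2.trans_lt ht₂⟩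
  have hI' : ∀ t ∈ Icc t₁ t₂, t ∈ Icc 0 T := fun t ht => Ioo_subset_Icc_self (hI t ht)
  -- the mollification error at a fixed time
  have hmoll : ∀ t ∈ Icc 0 T, ‖heatExtension (FunctionSpaces.Torus.lift (v t)) τ y -
      FunctionSpaces.Torus.lift (v t) y‖ ≤ K₀ * C * τ ^ ((r : ℝ) / 2) := by
    intro t ht
    have hc : Continuous (FunctionSpaces.Torus.lift (v t)) :=
      FunctionSpaces.Torus.continuous_lift_iff.2 (h.smooth_velocity.isSmooth_slice ht).continuous
    exact norm_heatExtension_sub_self_le_of_holder hc (fun z => hV t ht _) C.coe_nonneg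
      (by exact_mod_cast hr0.le) (by exact_mod_cast hr1.le)
      (TorusHeat.norm_lift_sub_lift_le_of_holderWith (hH t ht)) hτ y
  -- the mean value inequality for the mollified velocity on `[t₁, t₂]`
  set M := KA * (V * C) * τ ^ (((r : ℝ) - 1) / 2) + KB * ρ * τ ^ (-(1 / 2 : ℝ)) + KC * |ν| * V * τ ^ (-γ) with hM
  have hMVT : ‖heatExtension (FunctionSpaces.Torus.lift (v t₂)) τ y -
      heatExtension (FunctionSpaces.Torus.lift (v t₁)) τ y‖ ≤ M * (t₂ - t₁) := by
    refine norm_image_sub_le_of_norm_deriv_le_segment'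
      (f := fun s => heatExtension (FunctionSpaces.Torus.lift (v s)) τ y)
      (fun t ht => (hasDerivAt_heatExtension_lift hT h.smooth_velocity hτ y (hI t ht)).hasDerivWithinAt)
      (fun t ht => ?_) t₂ (right_mem_Icc.2 ht₁₂)
    exact hB h (hI t (Ico_subset_Icc_self ht)) (hH t (hI' t (Ico_subset_Icc_self ht)))
      (hV t (hI' t (Ico_subset_Icc_self ht))) (hρ t (hI' t (Ico_subset_Icc_self ht))) hτ y
  have h1 := hmoll t₁ (hI' t₁ (left_mem_Icc.2 ht₁₂))
  have h2 := hmoll t₂ (hI' t₂ (right_mem_Icc.2 ht₁₂))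
  calc ‖FunctionSpaces.Torus.lift (v t₂) y - FunctionSpaces.Torus.lift (v t₁) y‖
      = ‖-(heatExtension (FunctionSpaces.Torus.lift (v t₂)) τ y - FunctionSpaces.Torus.lift (v t₂) y) +
          (heatExtension (FunctionSpaces.Torus.lift (v t₂)) τ y -
            heatExtension (FunctionSpaces.Torus.lift (v t₁)) τ y) +
          (heatExtension (FunctionSpaces.Torus.lift (v t₁)) τ y - FunctionSpaces.Torus.lift (v t₁) y)‖ := by
        congr 1; abel
    _ ≤ ‖heatExtension (FunctionSpaces.Torus.lift (v t₂)) τ y - FunctionSpaces.Torus.lift (v t₂) y‖ +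
          ‖heatExtension (FunctionSpaces.Torus.lift (v t₂)) τ y -
            heatExtension (FunctionSpaces.Torus.lift (v t₁)) τ y‖ +
          ‖heatExtension (FunctionSpaces.Torus.lift (v t₁)) τ y - FunctionSpaces.Torus.lift (v t₁) y‖ := by
        refine (norm_add_le _ _).trans (add_le_add ((norm_add_le _ _).trans (add_le_add ?_ le_rfl)) le_rfl)
        rw [norm_neg]
    _ ≤ K₀ * C * τ ^ ((r : ℝ) / 2) + M * (t₂ - t₁) + K₀ * C * τ ^ ((r : ℝ) / 2) :=
        add_le_add (add_le_add h2 hMVT) h1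
    _ = _ := by rw [hM]; ring

end Torus

/-! ## The limit `q → ∞`: time regularity of the uniform limit -/

namespace DeRosa

variable {d : Type*} [Fintype d] [DecidableEq d]

/-- **Time regularity at interior times** (De Rosa 2019, §4.2, after BDSV 2019, §2.2). Let
`(v_q, p_q, R_q)` be classical solutions of the fractional Navier–Stokes–Reynolds system with
exponent `0 < γ < 1` and viscosity `ν` on `[0,T] × T^d` with `v_q → u` uniformly, `‖R_q‖₀ → 0`,
`[v_q(t)]_r ≤ C` and `‖v_q‖ ≤ V` for `q ≥ N₁` (`0 < r < 1`). Then for `0 < t₁ ≤ t₂ < T` and every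
`x`, `‖u(t₂,x) - u(t₁,x)‖ ≤ (2 K₀ C + K_A V C) (t₂ - t₁)^r + K_C |ν| V (t₂ - t₁)^{1-2γ}`:
apply `Torus.exists_norm_lift_sub_lift_le_frac` with `τ = (t₂ - t₁)²` and let `q → ∞` (the
stress term disappears). [cite: Derosa2018, §4.2 (proof of Thm. 2.1, time regularity)] -/
theorem exists_norm_sub_le_of_unifLimit (d : Type*) [Fintype d] [DecidableEq d]
    {r : ℝ≥0} (hr0 : 0 < r) (hr1 : r < 1) {γ : ℝ} (hγ0 : 0 < γ) (hγ1 : γ < 1) :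
    ∃ K₀ KA KC : ℝ, 0 ≤ K₀ ∧ 0 ≤ KA ∧ 0 ≤ KC ∧
      ∀ {T ν : ℝ} (_hT : 0 < T) {v : ℕ → ℝ → UnitAddTorus d → EuclideanSpace ℝ d}
        {p : ℕ → ℝ → UnitAddTorus d → ℝ} {R : ℕ → ℝ → UnitAddTorus d → d → EuclideanSpace ℝ d}
        {u : ℝ → UnitAddTorus d → EuclideanSpace ℝ d}
        (_hE : ∀ q, Torus.IsFracNSReynoldsOn (Icc 0 T) γ ν (v q) (p q) (R q))
        (_hv : ∀ ε > 0, ∃ N : ℕ, ∀ q ≥ N, ∀ t ∈ Icc 0 T, ∀ x, ‖v q t x - u t x‖ ≤ ε)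
        (_hR : ∀ ε > 0, ∃ N : ℕ, ∀ q ≥ N, ∀ t ∈ Icc 0 T, ∀ x, ‖R q t x‖ ≤ ε)
        {C : ℝ≥0} (_hH : ∀ q, ∀ t ∈ Icc 0 T, HolderWith C r (v q t)) {N₁ : ℕ} {V : ℝ}
        (_hV : ∀ q, N₁ ≤ q → ∀ t ∈ Icc 0 T, ∀ z, ‖v q t z‖ ≤ V) {t₁ t₂ : ℝ} (_ht₁ : 0 < t₁)
        (_ht₁₂ : t₁ ≤ t₂) (_ht₂ : t₂ < T) (x : UnitAddTorus d),
        ‖u t₂ x - u t₁ x‖ ≤ (2 * K₀ * C + KA * (V * C)) * (t₂ - t₁) ^ (r : ℝ) +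
          KC * |ν| * V * (t₂ - t₁) ^ (1 - 2 * γ) := by
  obtain ⟨K₀, KA, KB, KC, hK₀, hKA, hKB, hKC, hS⟩ := Torus.exists_norm_lift_sub_lift_le_frac d hr0 hr1 hγ0 hγ1
  refine ⟨K₀, KA, KC, hK₀, hKA, hKC, ?_⟩
  intro T ν hT v p R u hE hv hR C hH N₁ V hV t₁ t₂ ht₁ ht₁₂ ht₂ x
  have hV0 : 0 ≤ V := (norm_nonneg _).trans (hV N₁ le_rfl t₁ ⟨ht₁.le, ht₁₂.trans ht₂.le⟩ 0)
  rcases eq_or_lt_of_le ht₁₂ with heq | hlt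
  · subst heq
    rw [sub_self, norm_zero, sub_self]
    have h1 : 0 ≤ (0 : ℝ) ^ (r : ℝ) := Real.rpow_nonneg le_rfl _
    have h2 : 0 ≤ (0 : ℝ) ^ (1 - 2 * γ) := Real.rpow_nonneg le_rfl _
    positivity
  obtain ⟨y, rfl⟩ := FunctionSpaces.Torus.proj_surjective x
  have hδ : 0 < t₂ - t₁ := sub_pos.2 hlt
  set τ : ℝ := (t₂ - t₁) ^ 2 with hτ_def
  have hτ : 0 < τ := by positivity
  -- the three powers of `τ`
  have hτ1 : τ ^ ((r : ℝ) / 2) = (t₂ - t₁) ^ (r : ℝ) := by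
    rw [hτ_def, ← Real.rpow_natCast, ← Real.rpow_mul hδ.le]
    congr 1; push_cast; ring
  have hτ2 : (t₂ - t₁) * τ ^ (((r : ℝ) - 1) / 2) = (t₂ - t₁) ^ (r : ℝ) := by
    rw [hτ_def, ← Real.rpow_natCast, ← Real.rpow_mul hδ.le,
      show ((2 : ℕ) : ℝ) * (((r : ℝ) - 1) / 2) = (r : ℝ) - 1 by push_cast; ring,
      Real.rpow_sub_one hδ.ne', mul_div_cancel₀ _ hδ.ne']
  have hτ3 : (t₂ - t₁) * τ ^ (-γ) = (t₂ - t₁) ^ (1 - 2 * γ) := by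
    rw [hτ_def, ← Real.rpow_natCast, ← Real.rpow_mul hδ.le,
      show ((2 : ℕ) : ℝ) * (-γ) = (1 - 2 * γ) - 1 by push_cast; ring,
      Real.rpow_sub_one hδ.ne', mul_div_cancel₀ _ hδ.ne']
  refine le_of_forall_pos_le_add fun ε hε => ?_
  -- choose the stress so small that its contribution is below `ε/2`
  set L : ℝ := (t₂ - t₁) * (KB * τ ^ (-(1 / 2 : ℝ))) with hL
  have hL0 : 0 ≤ L := by positivity
  obtain ⟨N₂, hN₂⟩ := hR (ε / (2 * (L + 1))) (by positivity)
  obtain ⟨N₃, hN₃⟩ := hv (ε / 4) (by positivity)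
  set q := max N₁ (max N₂ N₃) with hq
  have hq₁ : N₁ ≤ q := le_max_left _ _
  have hq₂ : N₂ ≤ q := (le_max_left _ _).trans (le_max_right _ _)
  have hq₃ : N₃ ≤ q := (le_max_right _ _).trans (le_max_right _ _)
  have hinc := hS (hE q) hT ht₁ ht₁₂ ht₂ (hH q) (hV q hq₁) (fun t ht z => hN₂ q hq₂ t ht z) hτ y
  have ht₁I : t₁ ∈ Icc 0 T := ⟨ht₁.le, ht₁₂.trans ht₂.le⟩
  have ht₂I : t₂ ∈ Icc 0 T := ⟨ht₁.le.trans ht₁₂, ht₂.le⟩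
  have e₁ := hN₃ q hq₃ t₁ ht₁I (FunctionSpaces.Torus.proj y)
  have e₂ := hN₃ q hq₃ t₂ ht₂I (FunctionSpaces.Torus.proj y)
  simp only [FunctionSpaces.Torus.lift_apply] at hinc
  -- the stress contribution
  have hstress : (t₂ - t₁) * (KB * (ε / (2 * (L + 1))) * τ ^ (-(1 / 2 : ℝ))) ≤ ε / 2 := by
    have h1 : (t₂ - t₁) * (KB * (ε / (2 * (L + 1))) * τ ^ (-(1 / 2 : ℝ))) = L / (L + 1) * (ε / 2) := by
      rw [hL]; field_simp
    rw [h1]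
    have h2 : L / (L + 1) ≤ 1 := (div_le_one (by positivity)).2 (by linarith)
    calc L / (L + 1) * (ε / 2) ≤ 1 * (ε / 2) := mul_le_mul_of_nonneg_right h2 (by positivity)
      _ = ε / 2 := one_mul _
  calc ‖u t₂ (FunctionSpaces.Torus.proj y) - u t₁ (FunctionSpaces.Torus.proj y)‖
      = ‖(v q t₂ (FunctionSpaces.Torus.proj y) - v q t₁ (FunctionSpaces.Torus.proj y)) -
          (v q t₂ (FunctionSpaces.Torus.proj y) - u t₂ (FunctionSpaces.Torus.proj y)) +
          (v q t₁ (FunctionSpaces.Torus.proj y) - u t₁ (FunctionSpaces.Torus.proj y))‖ := by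
        congr 1; abel
    _ ≤ ‖v q t₂ (FunctionSpaces.Torus.proj y) - v q t₁ (FunctionSpaces.Torus.proj y)‖ +
          ‖v q t₂ (FunctionSpaces.Torus.proj y) - u t₂ (FunctionSpaces.Torus.proj y)‖ +
          ‖v q t₁ (FunctionSpaces.Torus.proj y) - u t₁ (FunctionSpaces.Torus.proj y)‖ :=
        (norm_add_le _ _).trans (add_le_add (norm_sub_le _ _) le_rfl)
    _ ≤ (2 * (K₀ * C * τ ^ ((r : ℝ) / 2)) +
          (t₂ - t₁) * (KA * (V * C) * τ ^ (((r : ℝ) - 1) / 2) +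
            KB * (ε / (2 * (L + 1))) * τ ^ (-(1 / 2 : ℝ)) + KC * |ν| * V * τ ^ (-γ))) + ε / 4 + ε / 4 :=
        add_le_add (add_le_add hinc e₂) e₁
    _ = (2 * K₀ * C + KA * (V * C)) * (t₂ - t₁) ^ (r : ℝ) + KC * |ν| * V * (t₂ - t₁) ^ (1 - 2 * γ) +
          ((t₂ - t₁) * (KB * (ε / (2 * (L + 1))) * τ ^ (-(1 / 2 : ℝ))) + ε / 2) := by
        rw [hτ1, ← hτ2, ← hτ3]; ring
    _ ≤ (2 * K₀ * C + KA * (V * C)) * (t₂ - t₁) ^ (r : ℝ) + KC * |ν| * V * (t₂ - t₁) ^ (1 - 2 * γ) +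
          (ε / 2 + ε / 2) :=
        add_le_add le_rfl (add_le_add hstress le_rfl)
    _ = (2 * K₀ * C + KA * (V * C)) * (t₂ - t₁) ^ (r : ℝ) + KC * |ν| * V * (t₂ - t₁) ^ (1 - 2 * γ) + ε := by
        ring

/-- **Discharge of `DeRosa.timeRegularity`** (De Rosa 2019, §4.2, proof of Thm. 2.1, the
time-regularity step: "To recover the time regularity we fix a smooth standard mollifier `ψ` in
space … `‖(-Δ)^γ ṽ_q‖₀ ≤ ‖ṽ_q‖₁` … the series converges in `C⁰_x C^{β''}_t` … `v ∈ C^{β''}([0,1] × 𝕋³)`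
as desired, with `β'' < β' < β < 1/3` arbitrary"; the general theorem, with `β'' = β'`, is
Colombo–De Rosa 2020, Thm. 1.1). The uniform limit `u` of the velocities of classical fractional
Navier–Stokes–Reynolds triples (exponent `γ ∈ (0,1/3)`, viscosity `1`) on `[0,T] × T³` with
vanishing stress and uniform `C^{β'}_x` bounds is `C^{β''}` on `[0,T] × T³` for every `β'' < β'`
(indeed for `β'' = β'`).

Proof (as formalised: the Gauss–Weierstrass kernel in place of the mollifier `ψ_ℓ`, `ℓ = √τ`,
the heat flow in place of Schauder estimates, and the subordination bound
`‖e^{τΔ}(-Δ)^γ v‖₀ ≲ τ^{-γ}‖v‖₀` in place of `‖(-Δ)^γ ṽ‖₀ ≤ ‖ṽ‖₁`): for interior times,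
`‖v_q(t₂) - v_q(t₁)‖₀ ≤ 2‖e^{τΔ}v_q - v_q‖₀ + |t₂-t₁| ‖e^{τΔ}∂ₜv_q‖₀` with
`‖e^{τΔ}v - v‖₀ ≲ [v]_{β'} τ^{β'/2}` and, from `∂ₜv = div R - ∇p - div(v⊗v) - (-Δ)^γ v` and
`Δp = div div(R - v⊗v)` (the hypodissipative term is divergence free),
`‖e^{τΔ}∂ₜv_q‖₀ ≲ [v_q]_{β'}‖v_q‖₀ τ^{(β'-1)/2} + ‖R_q‖₀ τ^{-1/2} + ‖v_q‖₀ τ^{-γ}`; letting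
`q → ∞` removes the stress, and `τ = (t₂-t₁)²` gives
`‖u(t₂) - u(t₁)‖₀ ≲ |t₂-t₁|^{β'} + |t₂-t₁|^{1-2γ} ≲_T |t₂-t₁|^{β'}` (`1 - 2γ > 1/3 > β'`). With the
spatial bound `[u(t)]_{β'} ≤ C` and the product sup-metric this is `C^{β'}` on `[0,T] × T³`, and
`C^{β''}` for `β'' ≤ β'` since the set is bounded. [cite: Derosa2018, §4.2 (proof of Thm. 2.1, time regularity)] -/
theorem timeRegularity_holds : DeRosa.timeRegularity := by
  intro T hT γ hγ0 hγ3 β' hβ'0 hβ'3 v p R u hE hv hR hC β'' hβ''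
  obtain ⟨C, hC⟩ := hC
  have hβ'1 : β' < 1 := hβ'3.trans (by norm_num)
  have hγ1 : γ < 1 := hγ3.trans (by norm_num)
  have hβ'3r : (β' : ℝ) < 1 / 3 := by exact_mod_cast hβ'3
  -- continuity and boundedness of the limit; uniform bound on the velocities
  have huc : ContinuousOn (FunctionSpaces.Torus.stLift u) (Icc 0 T ×ˢ univ) :=
    Torus.continuousOn_stLift_of_unifLimit (fun q => (hE q).smooth_velocity.continuousOn_stLift) hv
  obtain ⟨U, hU⟩ := FunctionSpaces.Torus.exists_norm_le_of_continuousOn_of_isCompact huc isCompact_Icc subset_rfl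
  obtain ⟨N₁, hN₁⟩ := hv 1 one_pos
  have hV : ∀ q, N₁ ≤ q → ∀ t ∈ Icc 0 T, ∀ z, ‖v q t z‖ ≤ U + 1 := fun q hq t ht z => by
    calc ‖v q t z‖ = ‖(v q t z - u t z) + u t z‖ := by rw [sub_add_cancel]
      _ ≤ ‖v q t z - u t z‖ + ‖u t z‖ := norm_add_le _ _
      _ ≤ 1 + U := add_le_add (hN₁ q hq t ht z) (hU t ht z)
      _ = U + 1 := add_comm _ _
  have hU0 : 0 ≤ U + 1 := by
    have := (norm_nonneg _).trans (hU 0 ⟨le_rfl, hT.le⟩ 0)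
    linarith
  -- spatial Hölder bound of the limit
  have hspace : ∀ t ∈ Icc 0 T, HolderWith C β' (u t) := fun t ht =>
    BDSV.holderWith_of_unifLimit (fun q => hC q t ht) fun x => by
      rw [Metric.tendsto_atTop]
      intro ε hε
      obtain ⟨N, hN⟩ := hv (ε / 2) (half_pos hε)
      exact ⟨N, fun q hq => by rw [dist_eq_norm]; exact (hN q hq t ht x).trans_lt (half_lt_self hε)⟩
  -- time Hölder bound of the limit
  obtain ⟨K₀, KA, KC, hK₀, hKA, hKC, hD⟩ := exists_norm_sub_le_of_unifLimit (Fin 3) hβ'0 hβ'1 hγ0 hγ1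
  set D₀ : ℝ := max T 1 with hD₀
  have hD₀1 : 1 ≤ D₀ := le_max_right _ _
  have hexp : 0 ≤ 1 - 2 * γ - (β' : ℝ) := by linarith
  set K : ℝ := 2 * K₀ * C + KA * ((U + 1) * C) + KC * |(1 : ℝ)| * (U + 1) * D₀ ^ (1 - 2 * γ - (β' : ℝ)) with hK
  have hK0 : 0 ≤ K := by positivity
  have hKint : ∀ t₁ t₂ : ℝ, 0 < t₁ → t₁ ≤ t₂ → t₂ < T → ∀ x, ‖u t₂ x - u t₁ x‖ ≤ K * (t₂ - t₁) ^ (β' : ℝ) := by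
    intro t₁ t₂ ht₁ ht₁₂ ht₂ x
    have h1 := hD hT hE hv hR hC hV ht₁ ht₁₂ ht₂ x
    have hh0 : 0 ≤ t₂ - t₁ := sub_nonneg.2 ht₁₂
    have hhT : t₂ - t₁ ≤ D₀ := (by linarith : t₂ - t₁ ≤ T).trans (le_max_left _ _)
    have hpow : (t₂ - t₁) ^ (1 - 2 * γ) ≤ D₀ ^ (1 - 2 * γ - (β' : ℝ)) * (t₂ - t₁) ^ (β' : ℝ) := by
      rcases hh0.eq_or_lt with h0 | hpos
      · rw [← h0, Real.zero_rpow (by linarith : (1 - 2 * γ : ℝ) ≠ 0)]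
        positivity
      · have hsplit : (t₂ - t₁) ^ (1 - 2 * γ) =
            (t₂ - t₁) ^ (1 - 2 * γ - (β' : ℝ)) * (t₂ - t₁) ^ (β' : ℝ) := by
          rw [← Real.rpow_add hpos]
          congr 1
          ring
        rw [hsplit]
        exact mul_le_mul_of_nonneg_right (Real.rpow_le_rpow hh0 hhT hexp) (Real.rpow_nonneg hh0 _)
    calc ‖u t₂ x - u t₁ x‖
        ≤ (2 * K₀ * C + KA * ((U + 1) * C)) * (t₂ - t₁) ^ (β' : ℝ) +
            KC * |(1 : ℝ)| * (U + 1) * (t₂ - t₁) ^ (1 - 2 * γ) := h1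
      _ ≤ (2 * K₀ * C + KA * ((U + 1) * C)) * (t₂ - t₁) ^ (β' : ℝ) +
            KC * |(1 : ℝ)| * (U + 1) * (D₀ ^ (1 - 2 * γ - (β' : ℝ)) * (t₂ - t₁) ^ (β' : ℝ)) :=
          add_le_add le_rfl (mul_le_mul_of_nonneg_left hpow (by positivity))
      _ = K * (t₂ - t₁) ^ (β' : ℝ) := by rw [hK]; ring
  have htime : ∀ t₁ ∈ Icc 0 T, ∀ t₂ ∈ Icc 0 T, ∀ x, ‖u t₂ x - u t₁ x‖ ≤ K * |t₂ - t₁| ^ (β' : ℝ) := by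
    intro t₁ ht₁ t₂ ht₂ x
    rcases le_total t₁ t₂ with h12 | h21
    · rw [abs_of_nonneg (sub_nonneg.2 h12)]
      exact BDSV.norm_sub_le_Icc_of_Ioo huc hβ'0 hKint ht₁ ht₂ h12 x
    · rw [abs_of_nonpos (sub_nonpos.2 h21), neg_sub, norm_sub_rev]
      exact BDSV.norm_sub_le_Icc_of_Ioo huc hβ'0 hKint ht₂ ht₁ h21 x
  -- space–time Hölder with exponent `β'`
  set K' : ℝ≥0 := Real.toNNReal K + C with hK'
  have hHolder : HolderOnWith K' β' (Function.uncurry u) (Icc 0 T ×ˢ univ) := by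
    refine BDSV.holderOnWith_of_dist_le fun P hP Q hQ => ?_
    obtain ⟨t, x⟩ := P
    obtain ⟨s, y⟩ := Q
    have ht : t ∈ Icc 0 T := (mem_prod.1 hP).1
    have hs : s ∈ Icc 0 T := (mem_prod.1 hQ).1
    have hdt : |s - t| ≤ dist (t, x) (s, y) := by
      rw [Prod.dist_eq, abs_sub_comm, ← Real.dist_eq]; exact le_max_left _ _
    have hdx : dist x y ≤ dist (t, x) (s, y) := by rw [Prod.dist_eq]; exact le_max_right _ _
    simp only [Function.uncurry_apply_pair]
    calc dist (u t x) (u s y) ≤ dist (u t x) (u s x) + dist (u s x) (u s y) := dist_triangle _ _ _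
      _ ≤ K * |s - t| ^ (β' : ℝ) + C * dist x y ^ (β' : ℝ) := by
          refine add_le_add ?_ ((hspace s hs).dist_le x y)
          rw [dist_eq_norm, norm_sub_rev]
          exact htime t ht s hs x
      _ ≤ K * dist (t, x) (s, y) ^ (β' : ℝ) + C * dist (t, x) (s, y) ^ (β' : ℝ) := by
          gcongr
      _ = K' * dist (t, x) (s, y) ^ (β' : ℝ) := by rw [hK', NNReal.coe_add, Real.coe_toNNReal K hK0]; ring
  -- lower the exponent on the bounded set `[0,T] × T³`
  set D : ℝ≥0 := ⟨max T 1, le_max_of_le_right zero_le_one⟩ with hD_def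
  have hdiam : ∀ P ∈ Icc 0 T ×ˢ (univ : Set (UnitAddTorus (Fin 3))), ∀ Q ∈ Icc 0 T ×ˢ (univ : Set (UnitAddTorus (Fin 3))),
      edist P Q ≤ D := by
    rintro ⟨t, x⟩ hP ⟨s, y⟩ hQ
    have ht : t ∈ Icc 0 T := (mem_prod.1 hP).1
    have hs : s ∈ Icc 0 T := (mem_prod.1 hQ).1
    rw [edist_dist, Prod.dist_eq, ← ENNReal.ofReal_coe_nnreal]
    refine ENNReal.ofReal_le_ofReal (max_le ?_ ?_)
    · rw [Real.dist_eq]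
      exact (abs_sub_le_iff.2 ⟨by linarith [ht.2, hs.1], by linarith [hs.2, ht.1]⟩).trans (le_max_left _ _)
    · exact ((FunctionSpaces.Torus.dist_le_half x y).trans (by norm_num)).trans (le_max_right T 1)
  exact ⟨_, hHolder.of_le hdiam hβ''.le⟩

end DeRosa

end Literature.Analysis.FluidPDE
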